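import Literature.MathematicalPhysics.QuantumFieldTheory.Balaban1983to89.B3Eq15ChargeDerivative

/-!
# `Balaban1983to89.B3Eq15ChargeSecondOrder` — T. Bałaban, *(Higgs)₂,₃ quantum fields in a finite volume. III.
Renormalization*, Commun. Math. Phys. **88** (1983) 411–445 [Balaban1983Higgs3], (1.4)–(1.7) pp. 412–413 [PDF 2–3]:
**the repaired interaction (1.5) TO SECOND ORDER at the typed `E_k` — all five terms
`(α, β) ∈ {(1,0), (0,1), (2,0), (1,1), (0,2)}` are genuine derivatives with closed forms:
`𝒫^{(k)}_{n̄=2} = ⟨cv⟩₀ + ⟨V⟩₀ + ½(⟨∂_{e′}cv⟩₀ − Var₀ cv) + (⟨∂_{e′}V⟩₀ − Cov₀(V, cv)) + ½(⟨∂_{λ′}V⟩₀ − Var₀ V)`**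
(`interaction15R_two_eq_expectations`), `cv` the charge vertex of `B3Eq15ChargeDerivative`, `V` the `λ′`-vertex of
`B3Eq14Finite`.  Successor of the typer's `B3Eq14Finite` §10 (the `(0,2)` term), `B3Eq14LamAllOrders` (all `(0,β)`),
and `B3Eq15ChargeDerivative` (the `(1,0)` term); this file supplies `(2,0)` and `(1,1)` and assembles `n̄ = 2`.

statement-level skeleton of published theorems with citation tags; proofs where landed; nothing here is a claim about
the Yang–Mills mass gap

THE ARGUMENT (ours; what the second-order terms of the printed (1.5) presuppose, for the typed instance `Data14.auxE`).
(2,0): every factor of the charge vertex `cv = kernelVertex + densityVertex` of `B3Eq15ChargeDerivative` is again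
differentiable in `e′` — the second derivative of the transport along the affine field `e′g_kA′ + A^{(k)}` is
`(e·a_x(A′))²q²U` ((I.1.7)), whence `∂²_{e′}` of the block averages (`d2AvgQ14`), of the kernel vertex
(`dKernelVertex`, `hasDerivAt_kernelVertex`: `−κΣ_y(⟨φ − Q_kφ′, ∂²Q_kφ′⟩ − |∂Q_kφ′|²)`), of the covariant derivatives
(`d2CovDeriv`, `dDirichletVertex`) and of the density vertex (`dDensityVertex`, data `C²` in `e′`); so
`∂²_{e′}(t·exp[…]) = (cv² − ∂_{e′}cv)·t·exp[…]` (`hasDerivAt_chargeDeriv_fibre14`).  With `|cv| ≤ (K₀+K₁‖A′‖)(1+S)²`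
and `|∂_{e′}cv| ≤ (K₀′+K₂′‖A′‖²)(1+S)²` (`S = Σ_x|φ′(x)|²`; §2–§3, isometric transports, `|qw| ≤ |w|`), the Gaussian
domination `t·exp[…] ≤ M e^{−2cS}` (`exists_fibre14_le_exp`, mass `≥ m₀` on `Ω₁` uniformly in `e′`) and
`(1+S)⁴e^{−2cS} ≤ 24c⁻⁴e^{c}e^{−cS}`, ONE majorant `(J₀ + J₂‖A′‖²)·M′·Π_xe^{−c|φ′(x)|²}` of both pieces `cv²·t·exp`,
`∂cv·t·exp` (`exists_chargeDeriv2_majorant`), integrable by the SECOND MOMENT of the fluctuation family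
(`HiggsFluctMeasureExpMoments.integrable_of_polyGrowth_fluctFamily`); dominated differentiation of
`N(e′) = ∫∫cv·t·exp` (`hasDerivAt_integral_chargeVertex_mul`; measurability of `cv(e′,·)` as the `e′`-derivative of
`−log(t·exp[…])`, `aestronglyMeasurable_chargeVertex`) and the quotient rule for `∂_{e′}E_k = N/Z`
(`B3Eq15ChargeDerivative.hasDerivAt_auxE_charge` at every `e′` near `e′₀`) give
`∂²_{e′}E_k = ⟨∂_{e′}cv⟩ − (⟨cv²⟩ − ⟨cv⟩²)` (`iteratedDeriv_two_auxE_charge`).  (1,1): for every `e′` near `e′₀` the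
right `λ′`-derivative is `∂⁺_{λ′}E_k(e′, 0) = ⟨V⟩_{e′} = N_V(e′)/Z(e′)` (`B3Eq14Finite.derivWithin_auxE_lam_Ici`, H7 at
`e′`); `V = λ(L^kε)Σ_{Ω₁}η^d|φ′|⁴ + ½Σ_{Ω₁}η^d∂_{λ′}δm²(L^kε)²|φ′|² + ∂_{λ′}E₁` depends on `e′` through the
counterterms only (`dLamVertexCharge`, `hasDerivAt_lamVertex_charge`), `|V| ≤ K_V(1+S)²`
(`Σ_{Ω₁}η^d|φ′|⁴ ≤ η^dS²`, `abs_lamVertex_le`), so `∂_{e′}(V·t·exp) = (∂_{e′}V − V·cv)·t·exp` has the majorant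
`exists_mixedDeriv_majorant` (first moment), `N_V′ = ∫∫(∂_{e′}V − V·cv)·t·exp` (`hasDerivAt_integral_lamVertex_mul`) and
`∂_{e′}∂⁺_{λ′}E_k = ⟨∂_{e′}V⟩ − (⟨V·cv⟩ − ⟨V⟩⟨cv⟩)` (`deriv_iteratedDerivWithin_auxE_mixed`).

WHAT IS PROVED (theorems; seven `def`s — `d2AvgQ14`, `dKernelVertex`, `d2CovDeriv`, `dDirichletVertex`,
`dDensityVertex`, `dChargeVertex`, `dLamVertexCharge` —, no `Prop` fact; axioms standard):
* §0 (private toolbox): copies of `B3Eq15ChargeDerivative`'s private helpers (`hasDerivAt_U_aff`, `sum_norm_le`,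
  `exists_abs_le_of_continuous`, `aestronglyMeasurable_of_hasDerivAt_param`);
* §1 `d2AvgQ14`, `hasDerivAt_dAvgQ14_apply`, `dKernelVertex`, **`hasDerivAt_kernelVertex`**, `d2CovDeriv`,
  `hasDerivAt_dCovDeriv`, `dDirichletVertex`, `hasDerivAt_dirichletVertex`, `dDensityVertex`,
  **`hasDerivAt_densityVertex`**, `dChargeVertex`, **`hasDerivAt_chargeVertex`**, **`hasDerivAt_chargeDeriv_fibre14`**;
* §2 `norm_d2AvgQ14_le`, `abs_dKernelVertex_le`, `norm_d2CovDeriv_le`, `abs_dDirichletVertex_le`, `abs_dDensityVertex_le`;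
* §3 `exists_abs_chargeVertex_le`, `exists_abs_dChargeVertex_le`, `exists_fibre14_le_exp`,
  **`exists_chargeDeriv2_majorant`** (private: `integrable_affine_mul_gauss`, `integrable_quad_mul_gauss`,
  `one_add_pow_four_mul_exp_le`; §5's `mixed_pieces_le`);
* §4 `kernel14_pos`, `aestronglyMeasurable_chargeVertex`, **`hasDerivAt_integral_chargeVertex_mul`**,
  **`iteratedDeriv_two_auxE_charge`** (`∂²_{e′}E_k(e′₀,λ′) = ⟨∂_{e′}cv⟩ − Var cv`);
* §5 `dLamVertexCharge`, `hasDerivAt_lamVertex_charge`, `sum_quartic_le_sqSum_sq`, `abs_lamVertex_le`,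
  `abs_dLamVertexCharge_le`, `aestronglyMeasurable_lamVertex_mul`, **`exists_mixedDeriv_majorant`**,
  **`hasDerivAt_integral_lamVertex_mul`**, **`deriv_iteratedDerivWithin_auxE_mixed`**
  (`∂_{e′}[∂⁺_{λ′}E_k(e′,0)]|_{e′₀} = ⟨∂_{e′}V⟩ − Cov(V, cv)`);
* §6 `idx15_two`, `interaction15R_two_eq_derivs` (bookkeeping: the five derivative symbols with weights `1,1,½,1,½`),
  **`interaction15R_two_eq_expectations`** (the five closed forms at `e′ = λ′ = 0`).
Hypotheses (H2, capstone): `μ₀² > 0`, `a > 0`, `L > 1`, `1 ≤ k ≤ K`, `L^kε ≠ 0`, `λ(L^kε) ≥ 0`, `0 < m₀ ≤ m²`,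
renormalized mass `m² + δm²(e′,λ′,x) ≥ m₀` on `Ω₁` for `(e′,λ′) ∈ [−ρ,ρ]×[0,δ]`; data: `δm²(0,·,x)`, `E₁(0,·)` of class
`C²`; `δm²(e′,·,x)`, `E₁(e′,·)` of class `C¹` for `|e′| ≤ ρ`; `δm²(·,0,x)`, `E₁(·,0)` of class `C²`;
`∂_{λ′}δm²(·,0,x)`, `∂_{λ′}E₁(·,0)` of class `C¹` (all automatic for the printed polynomial counterterms, an instance
not built here).
HONEST SCOPE: second TOTAL order only (`α + β ≤ 2`); nothing about `α + β ≥ 3` with `α ≥ 1`, no joint `C²`-regularity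
of `E_k` in `(e′, λ′)` (only the iterated derivatives named by `interaction15R` are treated, in its order: inner `λ′`
one-sided, outer `e′` two-sided), no symmetry `∂_{e′}∂_{λ′} = ∂_{λ′}∂_{e′}` asserted; the expectations are LEFT as
normalized product integrals — no Wick/cumulant closed form, no identification with the graphs of III §2.

presearch (2026-08-22, corpus fts+vec and galaxy): as for `B3Eq15ChargeDerivative` — no held or indexed source treats
the derivatives of Bałaban's `E_k` beyond [Balaban1983Higgs3]; the argument is ours from (I.1.7), (I.2.1)–(I.2.6),
(III.1.3)–(1.7).

PDF held: `paper:balaban1983-higgs-2-3-quantum-fields-finite-volume` (journal page = PDF page + 410); (1.3)–(1.7)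
pp. 412–413 [PDF 2–3] read from the render `run/shared/lean/pub/pub-balaban/b2b-balaban-ref1/pages/` (paper III
p002–p003) by typer g4/g24; [Balaban1982Higgs1] (1.7) p. 605, (2.1)–(2.6) p. 608.

CITATION HEADER (lean-in-tree rule).  lit-balaban TYPED SKELETON (HOME `run/shared/lean/pub/lit-balaban/`), rows
**B3.Eq1.4** / **B3.Eq1.5** (owner r15; decls of record `B3Eq14AuxFunction.Data14.auxE`,
`B3Eq15OneSidedInteraction.interaction15R`); unit `lit-balaban-typer` (literature-prover-lit-balaban-typer-g26-0).
Nothing of any other seat is touched; no row changes head (regularity results about the typed instance).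
-/

open _root_.MeasureTheory
open scoped InnerProductSpace

namespace Literature.MathematicalPhysics.QuantumFieldTheory.Balaban1983to89.B3Eq15ChargeSecondOrder

open Literature.MathematicalPhysics.QuantumFieldTheory.Balaban1983to89.HiggsLattice
open Literature.MathematicalPhysics.QuantumFieldTheory.Balaban1983to89.HiggsAveraging
open Literature.MathematicalPhysics.QuantumFieldTheory.Balaban1983to89.HiggsCovariance
open Literature.MathematicalPhysics.QuantumFieldTheory.Balaban1983to89.HiggsCovariancePos
open Literature.MathematicalPhysics.QuantumFieldTheory.Balaban1983to89.B3MultiscaleFields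
open Literature.MathematicalPhysics.QuantumFieldTheory.Balaban1983to89.HiggsFluctMeasure
open Literature.MathematicalPhysics.QuantumFieldTheory.Balaban1983to89.B1RT
open Literature.MathematicalPhysics.QuantumFieldTheory.Balaban1983to89.B3Eq14AuxFunction
open Literature.MathematicalPhysics.QuantumFieldTheory.Balaban1983to89.B3Eq15OneSidedInteraction
  (sqSum sqSum_nonneg prec_pos sq_le_sqSum)
open Literature.MathematicalPhysics.QuantumFieldTheory.Balaban1983to89.B3Eq14Finite
open Literature.MathematicalPhysics.QuantumFieldTheory.Balaban1983to89.B3Eq15ChargeDerivative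
open Set Filter Topology
open scoped BigOperators

noncomputable section

variable {P : HiggsLattice.Params} {N : ℕ}

/-! ## 0. Toolbox (private copies of the private helpers of `B3Eq15ChargeDerivative`, which a separate module
cannot see) -/

section Toolbox

/-- `d/ds U(a + sg)v = ηeg·qU(a + sg)v` for `U(A) = exp(qηeA)` ((I.1.7)). [cite: Balaban1982Higgs1, (1.7) p.605] -/
private theorem hasDerivAt_U_aff (C : HiggsLattice.ChargeData N) (η a g : ℝ) (v : EuclideanSpace ℝ (Fin N)) (t : ℝ) :
    HasDerivAt (fun s : ℝ => C.U η (a + s * g) v) ((η * C.e * g) • C.q (C.U η (a + t * g) v)) t := by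
  have hθ : HasDerivAt (fun s : ℝ => η * C.e * (a + s * g)) (η * C.e * g) t := by
    refine ((((hasDerivAt_id t).mul_const g).const_add a).const_mul (η * C.e)).congr_deriv ?_
    ring
  have hexp : HasDerivAt (fun u : ℝ => NormedSpace.exp (u • C.q))
      (C.q * NormedSpace.exp ((η * C.e * (a + t * g)) • C.q)) (η * C.e * (a + t * g)) :=
    hasDerivAt_exp_smul_const' C.q _
  have hcomp := hexp.scomp t hθ
  exact ((ContinuousLinearMap.apply ℝ (EuclideanSpace ℝ (Fin N)) v).hasFDerivAt).comp_hasDerivAt t hcomp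

/-- `|v| ≤ 1 + |v|²`. [folklore] -/
private theorem norm_le_one_add_sq (v : EuclideanSpace ℝ (Fin N)) : ‖v‖ ≤ 1 + ‖v‖ ^ 2 := by
  nlinarith [sq_nonneg (‖v‖ - 1), norm_nonneg v]

/-- `Σ_{x∈B}|φ′(x)| ≤ |T_η| + Σ_x|φ′(x)|²` for any set of sites `B`. [folklore] -/
private theorem sum_norm_le (B : Finset (HiggsLattice.Site P 0)) (φ' : HiggsLattice.ScalarField P 0 N) :
    ∑ x ∈ B, ‖φ' x‖ ≤ (Fintype.card (HiggsLattice.Site P 0) : ℝ) + sqSum φ' := by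
  calc ∑ x ∈ B, ‖φ' x‖ ≤ ∑ x, ‖φ' x‖ :=
        Finset.sum_le_sum_of_subset_of_nonneg (Finset.subset_univ B) fun x _ _ => norm_nonneg _
    _ ≤ ∑ x : HiggsLattice.Site P 0, (1 + ‖φ' x‖ ^ 2) := Finset.sum_le_sum fun x _ => norm_le_one_add_sq (φ' x)
    _ = (Fintype.card (HiggsLattice.Site P 0) : ℝ) + sqSum φ' := by
        rw [Finset.sum_add_distrib, Finset.sum_const, Finset.card_univ, nsmul_eq_mul, mul_one, sqSum]

/-- A continuous function is bounded in absolute value on `[a, b]` by a non-negative constant. [folklore] -/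
private theorem exists_abs_le_of_continuous {f : ℝ → ℝ} (hf : Continuous f) (a b : ℝ) :
    ∃ B : ℝ, 0 ≤ B ∧ ∀ s ∈ Set.Icc a b, |f s| ≤ B := by
  obtain ⟨C, hC⟩ := isCompact_Icc.exists_bound_of_continuousOn (hf.continuousOn (s := Set.Icc a b))
  exact ⟨max C 0, le_max_right _ _, fun s hs => ((Real.norm_eq_abs _).symm.le.trans (hC s hs)).trans (le_max_left _ _)⟩

/-- Measurability of an `e′`-derivative from that of the difference quotients (`F(e′, ·)` measurable for every `e′`).
[folklore] -/
private theorem aestronglyMeasurable_of_hasDerivAt_param {Z : Type*} [MeasurableSpace Z] {ν : Measure Z}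
    {F : ℝ → Z → ℝ} {G : Z → ℝ} {e₀ : ℝ} (hF : ∀ e, AEStronglyMeasurable (F e) ν)
    (hderiv : ∀ z, HasDerivAt (fun e => F e z) (G z) e₀) : AEStronglyMeasurable G ν := by
  set u : ℕ → ℝ := fun m => e₀ + 1 / ((m : ℝ) + 1) with hu
  have hu_tend : Tendsto u atTop (𝓝[≠] e₀) := by
    refine tendsto_nhdsWithin_of_tendsto_nhds_of_eventually_within _ ?_ (Eventually.of_forall fun m => ?_)
    · have h : Tendsto (fun m : ℕ => e₀ + 1 / ((m : ℝ) + 1)) atTop (𝓝 (e₀ + 0)) :=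
        tendsto_const_nhds.add tendsto_one_div_add_atTop_nhds_zero_nat
      rw [add_zero] at h
      exact h
    · simp only [hu, Set.mem_compl_iff, Set.mem_singleton_iff, add_eq_left, one_div, inv_eq_zero]
      exact Nat.cast_add_one_ne_zero m
  have hlim : ∀ z, Tendsto (fun m => slope (fun e => F e z) e₀ (u m)) atTop (𝓝 (G z)) :=
    fun z => (hderiv z).tendsto_slope.comp hu_tend
  refine aestronglyMeasurable_of_tendsto_ae atTop (fun m => ?_) (Eventually.of_forall hlim)
  have e : (fun z => slope (fun e => F e z) e₀ (u m)) = fun z => (u m - e₀)⁻¹ * (F (u m) z - F e₀ z) := by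
    funext z; rw [slope_def_field, div_eq_inv_mul]
  rw [e]
  exact ((hF (u m)).sub (hF e₀)).const_mul _

end Toolbox

/-! ## 1. Second `e′`-derivatives of the pieces: `∂_{e′}` of the kernel vertex, of the covariant-derivative vertex,
of the density vertex, of the charge vertex -/

section SecondDerivatives

variable {k : ℕ} (D : Data14 P N k)

/-- `d/ds [c·q U(a + sg)v] = c·q((ηeg)·q U(a + sg)v)`: a fixed multiple of `q` applied to the transport is again
differentiable in the charge parameter ((I.1.7)). [cite: Balaban1982Higgs1, (1.7) p.605] -/
private theorem hasDerivAt_smul_q_U_aff (C : HiggsLattice.ChargeData N) (c η a g : ℝ) (v : EuclideanSpace ℝ (Fin N))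
    (t : ℝ) :
    HasDerivAt (fun s : ℝ => c • C.q (C.U η (a + s * g) v))
      ((c * (η * C.e * g)) • C.q (C.q (C.U η (a + t * g) v))) t := by
  have h1 : HasDerivAt (fun s : ℝ => C.q (C.U η (a + s * g) v)) (C.q ((η * C.e * g) • C.q (C.U η (a + t * g) v))) t :=
    C.q.hasFDerivAt.comp_hasDerivAt t (hasDerivAt_U_aff C η a g v t)
  have h2 := h1.const_smul c
  rw [ContinuousLinearMap.map_smul, smul_smul] at h2
  exact h2

/-- The SECOND `e′`-DERIVATIVE OF THE AVERAGE `(Q_k(e′g_kA′ + A^{(k)})φ′)(y)`: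
`L^{−kd}Σ_{x∈B^k(y)} (e·a_x(A′))²·q²U(𝒜(Γ^{(k)}_{y,x}))φ′(x)`. (ours) [cite: Balaban1983Higgs3, (1.3)–(1.4) p.412] -/
noncomputable def d2AvgQ14 (Ak : HiggsLattice.VecField P 0) (A' : (j : Fin k) → HiggsLattice.VecField P j)
    (φ' : HiggsLattice.ScalarField P 0 N) (e : ℝ) (y : HiggsLattice.Site P k) : EuclideanSpace ℝ (Fin N) :=
  (((P.L : ℝ) ^ (k * P.d))⁻¹) • ∑ x ∈ blockK k y,
    (D.C.e * fluctContour D A' x) ^ 2 • D.C.q (D.C.q (holK13 D.C k (D.extPieces e A') Ak x (φ' x)))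

/-- Unfolding of `d2AvgQ14`. [cite: Balaban1983Higgs3, (1.3)–(1.4) p.412] -/
theorem d2AvgQ14_def (Ak : HiggsLattice.VecField P 0) (A' : (j : Fin k) → HiggsLattice.VecField P j)
    (φ' : HiggsLattice.ScalarField P 0 N) (e : ℝ) (y : HiggsLattice.Site P k) :
    d2AvgQ14 D Ak A' φ' e y = (((P.L : ℝ) ^ (k * P.d))⁻¹) • ∑ x ∈ blockK k y,
      (D.C.e * fluctContour D A' x) ^ 2 • D.C.q (D.C.q (holK13 D.C k (D.extPieces e A') Ak x (φ' x))) := rfl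

/-- **`e′ ↦ ∂_{e′}(Q_k(e′g_kA′ + A^{(k)})φ′)(y)` is differentiable**, with derivative `d2AvgQ14`.
[cite: Balaban1983Higgs3, (1.3)–(1.4) p.412] -/
theorem hasDerivAt_dAvgQ14_apply (Ak : HiggsLattice.VecField P 0) (A' : (j : Fin k) → HiggsLattice.VecField P j)
    (φ' : HiggsLattice.ScalarField P 0 N) (y : HiggsLattice.Site P k) (e : ℝ) :
    HasDerivAt (fun u => dAvgQ14 D Ak A' φ' u y) (d2AvgQ14 D Ak A' φ' e y) e := by
  have hx : ∀ x ∈ blockK k y, HasDerivAt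
      (fun u => (D.C.e * fluctContour D A' x) • D.C.q (holK13 D.C k (D.extPieces u A') Ak x (φ' x)))
      ((D.C.e * fluctContour D A' x) ^ 2 • D.C.q (D.C.q (holK13 D.C k (D.extPieces e A') Ak x (φ' x)))) e := by
    intro x _
    have h := hasDerivAt_smul_q_U_aff D.C (D.C.e * fluctContour D A' x) 1 (etaSumK Ak k x) (fluctContour D A' x)
      (φ' x) e
    have heq : ∀ u, holK13 D.C k (D.extPieces u A') Ak x = D.C.U 1 (etaSumK Ak k x + u * fluctContour D A' x) :=
      fun u => by rw [holK13, contour13_extPieces]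
    simp_rw [heq]
    refine h.congr_deriv ?_
    rw [one_mul, sq]
  simp only [dAvgQ14_def, d2AvgQ14_def]
  exact (HasDerivAt.fun_sum hx).const_smul (((P.L : ℝ) ^ (k * P.d))⁻¹)

/-- The `e′`-DERIVATIVE OF THE KERNEL VERTEX:
`−κΣ_{y∈Ω^{(k)}}(⟨φ(y) − (Q_kφ′)(y), ∂²_{e′}(Q_kφ′)(y)⟩ − |∂_{e′}(Q_kφ′)(y)|²)`. (ours) [cite: Balaban1983Higgs3, (1.4) p.412] -/
noncomputable def dKernelVertex (Ak : HiggsLattice.VecField P 0) (A' : (j : Fin k) → HiggsLattice.VecField P j)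
    (φ : HiggsLattice.ScalarField P k N) (φΩ : ↥D.Ω → EuclideanSpace ℝ (Fin N)) (e : ℝ) : ℝ :=
  -(prec (B1.aSeq D.a P.L k) (P.mesh k) P.d
    * ∑ y : ↥D.Ωk, (⟪φ y.1 - D.avgQ14 Ak e A' (extendZero D.Ω φΩ) y.1,
        d2AvgQ14 D Ak A' (extendZero D.Ω φΩ) e y.1⟫_ℝ - ‖dAvgQ14 D Ak A' (extendZero D.Ω φΩ) e y.1‖ ^ 2))

/-- Unfolding of `dKernelVertex`. [cite: Balaban1983Higgs3, (1.4) p.412] -/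
theorem dKernelVertex_def (Ak : HiggsLattice.VecField P 0) (A' : (j : Fin k) → HiggsLattice.VecField P j)
    (φ : HiggsLattice.ScalarField P k N) (φΩ : ↥D.Ω → EuclideanSpace ℝ (Fin N)) (e : ℝ) :
    dKernelVertex D Ak A' φ φΩ e = -(prec (B1.aSeq D.a P.L k) (P.mesh k) P.d
      * ∑ y : ↥D.Ωk, (⟪φ y.1 - D.avgQ14 Ak e A' (extendZero D.Ω φΩ) y.1,
          d2AvgQ14 D Ak A' (extendZero D.Ω φΩ) e y.1⟫_ℝ - ‖dAvgQ14 D Ak A' (extendZero D.Ω φΩ) e y.1‖ ^ 2)) := rfl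

/-- **The kernel vertex is differentiable in the charge**, with derivative `dKernelVertex`.
[cite: Balaban1983Higgs3, (1.4) p.412] -/
theorem hasDerivAt_kernelVertex (Ak : HiggsLattice.VecField P 0) (A' : (j : Fin k) → HiggsLattice.VecField P j)
    (φ : HiggsLattice.ScalarField P k N) (φΩ : ↥D.Ω → EuclideanSpace ℝ (Fin N)) (e : ℝ) :
    HasDerivAt (fun u => kernelVertex D Ak A' φ φΩ u) (dKernelVertex D Ak A' φ φΩ e) e := by
  set φ' := extendZero D.Ω φΩ with hφ'
  have hy : ∀ y : ↥D.Ωk, HasDerivAt (fun u => ⟪φ y.1 - D.avgQ14 Ak u A' φ' y.1, dAvgQ14 D Ak A' φ' u y.1⟫_ℝ)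
      (⟪φ y.1 - D.avgQ14 Ak e A' φ' y.1, d2AvgQ14 D Ak A' φ' e y.1⟫_ℝ - ‖dAvgQ14 D Ak A' φ' e y.1‖ ^ 2) e := by
    intro y
    have h1 : HasDerivAt (fun u => φ y.1 - D.avgQ14 Ak u A' φ' y.1) (-dAvgQ14 D Ak A' φ' e y.1) e :=
      (hasDerivAt_avgQ14_apply D Ak A' φ' y.1 e).const_sub (φ y.1)
    have h := h1.inner ℝ (hasDerivAt_dAvgQ14_apply D Ak A' φ' y.1 e)
    refine h.congr_deriv ?_
    rw [inner_neg_left, real_inner_self_eq_norm_sq]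
    ring
  simp only [kernelVertex_def, dKernelVertex_def]
  exact ((HasDerivAt.fun_sum fun y _ => hy y).const_mul _).neg

/-- The SECOND `e′`-DERIVATIVE OF THE COVARIANT DERIVATIVE `(D^η_{e′g_kA′+A^{(k)}}φ′)(b)`:
`η(e·G_b(A′))²·q²U((e′g_kA′+A^{(k)})(b))φ′(b₊)`. (ours) [cite: Balaban1982Higgs1, (1.7) p.605] -/
noncomputable def d2CovDeriv (Ak : HiggsLattice.VecField P 0) (A' : (j : Fin k) → HiggsLattice.VecField P j)
    (φ' : HiggsLattice.ScalarField P 0 N) (e : ℝ) (b : HiggsLattice.PBond P 0) : EuclideanSpace ℝ (Fin N) :=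
  (P.mesh 0 * (D.C.e * fluctBond D A' b) ^ 2) • D.C.q (D.C.q (D.C.U (P.mesh 0) (D.extField Ak e A' b) (φ' b.tgt)))

/-- Unfolding of `d2CovDeriv`. [cite: Balaban1982Higgs1, (1.7) p.605] -/
theorem d2CovDeriv_def (Ak : HiggsLattice.VecField P 0) (A' : (j : Fin k) → HiggsLattice.VecField P j)
    (φ' : HiggsLattice.ScalarField P 0 N) (e : ℝ) (b : HiggsLattice.PBond P 0) :
    d2CovDeriv D Ak A' φ' e b = (P.mesh 0 * (D.C.e * fluctBond D A' b) ^ 2)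
      • D.C.q (D.C.q (D.C.U (P.mesh 0) (D.extField Ak e A' b) (φ' b.tgt))) := rfl

/-- **`e′ ↦ ∂_{e′}(D^η_{e′g_kA′+A^{(k)}}φ′)(b)` is differentiable**, with derivative `d2CovDeriv`.
[cite: Balaban1982Higgs1, (1.7) p.605] -/
theorem hasDerivAt_dCovDeriv (Ak : HiggsLattice.VecField P 0) (A' : (j : Fin k) → HiggsLattice.VecField P j)
    (φ' : HiggsLattice.ScalarField P 0 N) (b : HiggsLattice.PBond P 0) (e : ℝ) :
    HasDerivAt (fun u => dCovDeriv D Ak A' φ' u b) (d2CovDeriv D Ak A' φ' e b) e := by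
  have h := hasDerivAt_smul_q_U_aff D.C (D.C.e * fluctBond D A' b) (P.mesh 0) (Ak b) (fluctBond D A' b) (φ' b.tgt) e
  have heq : (fun u => dCovDeriv D Ak A' φ' u b)
      = fun u => (D.C.e * fluctBond D A' b) • D.C.q (D.C.U (P.mesh 0) (Ak b + u * fluctBond D A' b) (φ' b.tgt)) := by
    funext u
    rw [dCovDeriv_def, extField_apply]
  rw [heq]
  refine h.congr_deriv ?_
  rw [d2CovDeriv_def, extField_apply]
  congr 1
  ring

/-- The `e′`-DERIVATIVE OF `dirichletVertex`:
`Σ_{b⊂Ω} η^d(⟨(D_𝒜φ′)(b), ∂²_{e′}(D_𝒜φ′)(b)⟩ + |∂_{e′}(D_𝒜φ′)(b)|²)`. (ours) [cite: Balaban1983Higgs3, (1.4) p.412] -/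
noncomputable def dDirichletVertex (Ak : HiggsLattice.VecField P 0) (A' : (j : Fin k) → HiggsLattice.VecField P j)
    (φ' : HiggsLattice.ScalarField P 0 N) (e : ℝ) : ℝ :=
  ∑ b : HiggsLattice.PBond P 0, if Inside D.Ω b then
    P.mesh 0 ^ P.d * (⟪covDeriv D.C (D.extField Ak e A') φ' b, d2CovDeriv D Ak A' φ' e b⟫_ℝ
      + ‖dCovDeriv D Ak A' φ' e b‖ ^ 2) else 0

/-- Unfolding of `dDirichletVertex`. [cite: Balaban1983Higgs3, (1.4) p.412] -/
theorem dDirichletVertex_def (Ak : HiggsLattice.VecField P 0) (A' : (j : Fin k) → HiggsLattice.VecField P j)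
    (φ' : HiggsLattice.ScalarField P 0 N) (e : ℝ) :
    dDirichletVertex D Ak A' φ' e = ∑ b : HiggsLattice.PBond P 0, if Inside D.Ω b then
      P.mesh 0 ^ P.d * (⟪covDeriv D.C (D.extField Ak e A') φ' b, d2CovDeriv D Ak A' φ' e b⟫_ℝ
        + ‖dCovDeriv D Ak A' φ' e b‖ ^ 2) else 0 := rfl

/-- **`dirichletVertex` is differentiable in the charge**, with derivative `dDirichletVertex`.
[cite: Balaban1983Higgs3, (1.4) p.412] -/
theorem hasDerivAt_dirichletVertex (Ak : HiggsLattice.VecField P 0) (A' : (j : Fin k) → HiggsLattice.VecField P j)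
    (φ' : HiggsLattice.ScalarField P 0 N) (e : ℝ) :
    HasDerivAt (fun u => dirichletVertex D Ak A' φ' u) (dDirichletVertex D Ak A' φ' e) e := by
  have hb : ∀ b : HiggsLattice.PBond P 0, HasDerivAt (fun u => if Inside D.Ω b then
      P.mesh 0 ^ P.d * ⟪covDeriv D.C (D.extField Ak u A') φ' b, dCovDeriv D Ak A' φ' u b⟫_ℝ else 0)
      (if Inside D.Ω b then P.mesh 0 ^ P.d * (⟪covDeriv D.C (D.extField Ak e A') φ' b, d2CovDeriv D Ak A' φ' e b⟫_ℝ
        + ‖dCovDeriv D Ak A' φ' e b‖ ^ 2) else 0) e := by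
    intro b
    by_cases hin : Inside D.Ω b
    · simp only [hin, if_true]
      have h := ((hasDerivAt_covDeriv D Ak A' φ' b e).inner ℝ (hasDerivAt_dCovDeriv D Ak A' φ' b e)).const_mul
        (P.mesh 0 ^ P.d)
      refine h.congr_deriv ?_
      rw [real_inner_self_eq_norm_sq]
    · simp only [hin, if_false]
      exact hasDerivAt_const e 0
  simp only [dirichletVertex_def, dDirichletVertex_def]
  exact HasDerivAt.fun_sum (u := Finset.univ) fun b _ => hb b

/-- The `e′`-DERIVATIVE OF THE DENSITY VERTEX: `dDirichletVertex + ½Σ_{x∈Ω₁}η^d(∂²_{e′}δm²)(e′,λ′,x)(L^kε)²|φ′(x)|² +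
(∂²_{e′}E₁)(e′,λ′)`. (ours) [cite: Balaban1983Higgs3, (1.4)–(1.7) pp.412–413] -/
noncomputable def dDensityVertex (Ak : HiggsLattice.VecField P 0) (lam' : ℝ)
    (A' : (j : Fin k) → HiggsLattice.VecField P j) (φ' : HiggsLattice.ScalarField P 0 N) (e : ℝ) : ℝ :=
  dDirichletVertex D Ak A' φ' e
    + (1 / 2 : ℝ) * ∑ x ∈ D.Ω₁, P.mesh 0 ^ P.d * deriv (deriv fun u => D.dm2 u lam' x) e * D.ell ^ 2 * ‖φ' x‖ ^ 2
    + deriv (deriv fun u => D.E1 u lam') e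

/-- Unfolding of `dDensityVertex`. [cite: Balaban1983Higgs3, (1.4)–(1.7) pp.412–413] -/
theorem dDensityVertex_def (Ak : HiggsLattice.VecField P 0) (lam' : ℝ)
    (A' : (j : Fin k) → HiggsLattice.VecField P j) (φ' : HiggsLattice.ScalarField P 0 N) (e : ℝ) :
    dDensityVertex D Ak lam' A' φ' e = dDirichletVertex D Ak A' φ' e
      + (1 / 2 : ℝ) * ∑ x ∈ D.Ω₁, P.mesh 0 ^ P.d * deriv (deriv fun u => D.dm2 u lam' x) e * D.ell ^ 2 * ‖φ' x‖ ^ 2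
      + deriv (deriv fun u => D.E1 u lam') e := rfl

/-- **The density vertex is differentiable in the charge**, with derivative `dDensityVertex`, wherever the first
`e′`-derivatives of the data `δm²(·,λ′,x)` (`x ∈ Ω₁`), `E₁(·,λ′)` are differentiable.
[cite: Balaban1983Higgs3, (1.4)–(1.7) pp.412–413] -/
theorem hasDerivAt_densityVertex (Ak : HiggsLattice.VecField P 0) (lam' : ℝ)
    (A' : (j : Fin k) → HiggsLattice.VecField P j) (φ' : HiggsLattice.ScalarField P 0 N) {e : ℝ}
    (hdm2 : ∀ x ∈ D.Ω₁, DifferentiableAt ℝ (deriv fun u => D.dm2 u lam' x) e)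
    (hE1 : DifferentiableAt ℝ (deriv fun u => D.E1 u lam') e) :
    HasDerivAt (fun u => densityVertex D Ak lam' A' φ' u) (dDensityVertex D Ak lam' A' φ' e) e := by
  have h1 := hasDerivAt_dirichletVertex D Ak A' φ' e
  have h3 : HasDerivAt
      (fun u : ℝ => ∑ x ∈ D.Ω₁, P.mesh 0 ^ P.d * deriv (fun u => D.dm2 u lam' x) u * D.ell ^ 2 * ‖φ' x‖ ^ 2)
      (∑ x ∈ D.Ω₁, P.mesh 0 ^ P.d * deriv (deriv fun u => D.dm2 u lam' x) e * D.ell ^ 2 * ‖φ' x‖ ^ 2) e := by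
    refine HasDerivAt.fun_sum (u := D.Ω₁)
      (A := fun x u => P.mesh 0 ^ P.d * deriv (fun u => D.dm2 u lam' x) u * D.ell ^ 2 * ‖φ' x‖ ^ 2)
      (A' := fun x => P.mesh 0 ^ P.d * deriv (deriv fun u => D.dm2 u lam' x) e * D.ell ^ 2 * ‖φ' x‖ ^ 2)
      fun x hx => ?_
    exact (((hdm2 x hx).hasDerivAt.const_mul (P.mesh 0 ^ P.d)).mul_const (D.ell ^ 2)).mul_const (‖φ' x‖ ^ 2)
  have h4 : HasDerivAt (fun u : ℝ => deriv (fun u => D.E1 u lam') u) (deriv (deriv fun u => D.E1 u lam') e) e :=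
    hE1.hasDerivAt
  have h := (h1.add (h3.const_mul (1 / 2 : ℝ))).add h4
  simp only [densityVertex_def, dDensityVertex_def]
  exact h

/-- The `e′`-DERIVATIVE OF THE CHARGE VERTEX on the product space: `dKernelVertex + dDensityVertex`. (ours)
[cite: Balaban1983Higgs3, (1.4)–(1.5) p.412] -/
noncomputable def dChargeVertex (lam' : ℝ) (Ak : HiggsLattice.VecField P 0) (φ : HiggsLattice.ScalarField P k N)
    (e : ℝ) (z : ((i : Fin k) → HiggsLattice.VecField P i) × (↥D.Ω → EuclideanSpace ℝ (Fin N))) : ℝ :=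
  dKernelVertex D Ak z.1 φ z.2 e + dDensityVertex D Ak lam' z.1 (extendZero D.Ω z.2) e

/-- Unfolding of `dChargeVertex`. [cite: Balaban1983Higgs3, (1.4)–(1.5) p.412] -/
theorem dChargeVertex_def (lam' : ℝ) (Ak : HiggsLattice.VecField P 0) (φ : HiggsLattice.ScalarField P k N) (e : ℝ)
    (z : ((i : Fin k) → HiggsLattice.VecField P i) × (↥D.Ω → EuclideanSpace ℝ (Fin N))) :
    dChargeVertex D lam' Ak φ e z
      = dKernelVertex D Ak z.1 φ z.2 e + dDensityVertex D Ak lam' z.1 (extendZero D.Ω z.2) e := rfl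

/-- **The charge vertex is differentiable in the charge**, with derivative `dChargeVertex`.
[cite: Balaban1983Higgs3, (1.4)–(1.5) p.412] -/
theorem hasDerivAt_chargeVertex (lam' : ℝ) (Ak : HiggsLattice.VecField P 0) (φ : HiggsLattice.ScalarField P k N)
    (z : ((i : Fin k) → HiggsLattice.VecField P i) × (↥D.Ω → EuclideanSpace ℝ (Fin N))) {e : ℝ}
    (hdm2 : ∀ x ∈ D.Ω₁, DifferentiableAt ℝ (deriv fun u => D.dm2 u lam' x) e)
    (hE1 : DifferentiableAt ℝ (deriv fun u => D.E1 u lam') e) :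
    HasDerivAt (fun u => chargeVertex D lam' Ak φ u z) (dChargeVertex D lam' Ak φ e z) e := by
  simp only [chargeVertex_def, dChargeVertex_def]
  exact (hasDerivAt_kernelVertex D Ak z.1 φ z.2 e).add
    (hasDerivAt_densityVertex D Ak lam' z.1 (extendZero D.Ω z.2) hdm2 hE1)

/-- **`∂²_{e′}(t(Ω;φ,φ′)·exp[…]) = ((charge vertex)² − ∂_{e′}(charge vertex))·t·exp[…]`**: the `e′`-derivative of
`−(charge vertex)·t·exp[…]` at a point where the data are twice differentiable in `e′`.
[cite: Balaban1983Higgs3, (1.4)–(1.5) p.412] -/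
theorem hasDerivAt_chargeDeriv_fibre14 (lam' : ℝ) (Ak : HiggsLattice.VecField P 0)
    (φ : HiggsLattice.ScalarField P k N)
    (z : ((i : Fin k) → HiggsLattice.VecField P i) × (↥D.Ω → EuclideanSpace ℝ (Fin N))) {e : ℝ}
    (hdm2 : ∀ x ∈ D.Ω₁, DifferentiableAt ℝ (fun u => D.dm2 u lam' x) e)
    (hE1 : DifferentiableAt ℝ (fun u => D.E1 u lam') e)
    (hdm2' : ∀ x ∈ D.Ω₁, DifferentiableAt ℝ (deriv fun u => D.dm2 u lam' x) e)
    (hE1' : DifferentiableAt ℝ (deriv fun u => D.E1 u lam') e) :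
    HasDerivAt (fun u => -chargeVertex D lam' Ak φ u z
        * (D.kernel14 Ak u z.1 φ z.2 * D.density14 Ak u lam' z.1 (extendZero D.Ω z.2)))
      ((chargeVertex D lam' Ak φ e z ^ 2 - dChargeVertex D lam' Ak φ e z)
        * (D.kernel14 Ak e z.1 φ z.2 * D.density14 Ak e lam' z.1 (extendZero D.Ω z.2))) e := by
  have h1 : HasDerivAt (fun u => -chargeVertex D lam' Ak φ u z) (-dChargeVertex D lam' Ak φ e z) e :=
    (hasDerivAt_chargeVertex D lam' Ak φ z hdm2' hE1').neg
  have h : HasDerivAt (fun u => -chargeVertex D lam' Ak φ u z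
        * (D.kernel14 Ak u z.1 φ z.2 * D.density14 Ak u lam' z.1 (extendZero D.Ω z.2)))
      (-dChargeVertex D lam' Ak φ e z * (D.kernel14 Ak e z.1 φ z.2 * D.density14 Ak e lam' z.1 (extendZero D.Ω z.2))
        + -chargeVertex D lam' Ak φ e z * (-chargeVertex D lam' Ak φ e z
          * (D.kernel14 Ak e z.1 φ z.2 * D.density14 Ak e lam' z.1 (extendZero D.Ω z.2)))) e :=
    h1.mul (hasDerivAt_fibre14_charge D lam' Ak φ z hdm2 hE1)
  refine h.congr_deriv ?_
  ring

end SecondDerivatives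

/-! ## 2. Bounds: `∂_{e′}(charge vertex)` grows at most like `(K₀′ + K₂′‖A′‖²)(1 + Σ_x|φ′(x)|²)²` -/

section SecondBounds

variable {k : ℕ} (D : Data14 P N k)

/-- `|∂²_{e′}(Q_k(𝒜)φ′)(y)| ≤ L^{−kd}(eC_a‖A′‖)²(|T_η| + Σ_x|φ′(x)|²)`. [cite: Balaban1983Higgs3, (1.4) p.412] -/
theorem norm_d2AvgQ14_le {Ca : ℝ}
    (hCa : ∀ (A' : (j : Fin k) → HiggsLattice.VecField P j) (x : HiggsLattice.Site P 0),
      |fluctContour D A' x| ≤ Ca * ‖A'‖)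
    (Ak : HiggsLattice.VecField P 0) (A' : (j : Fin k) → HiggsLattice.VecField P j)
    (φ' : HiggsLattice.ScalarField P 0 N) (e : ℝ) (y : HiggsLattice.Site P k) :
    ‖d2AvgQ14 D Ak A' φ' e y‖
      ≤ ((P.L : ℝ) ^ (k * P.d))⁻¹ * (|D.C.e| * Ca * ‖A'‖) ^ 2
          * ((Fintype.card (HiggsLattice.Site P 0) : ℝ) + sqSum φ') := by
  have hL0 : 0 ≤ ((P.L : ℝ) ^ (k * P.d))⁻¹ := by positivity
  rw [d2AvgQ14_def, norm_smul, Real.norm_of_nonneg hL0, mul_assoc]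
  refine mul_le_mul_of_nonneg_left ((norm_sum_le _ _).trans ?_) hL0
  have hx : ∀ x ∈ blockK k y,
      ‖(D.C.e * fluctContour D A' x) ^ 2 • D.C.q (D.C.q (holK13 D.C k (D.extPieces e A') Ak x (φ' x)))‖
        ≤ (|D.C.e| * Ca * ‖A'‖) ^ 2 * ‖φ' x‖ := by
    intro x _
    rw [norm_smul, Real.norm_of_nonneg (sq_nonneg _)]
    refine mul_le_mul ?_ ((norm_q_apply_le D.C _).trans ((norm_q_apply_le D.C _).trans
      (norm_holK13_apply D.C _ Ak x (φ' x)).le)) (norm_nonneg _) (by positivity)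
    rw [← sq_abs, abs_mul]
    refine pow_le_pow_left₀ (by positivity) ?_ 2
    rw [mul_assoc]
    exact mul_le_mul_of_nonneg_left (hCa A' x) (abs_nonneg _)
  refine (Finset.sum_le_sum hx).trans ?_
  rw [← Finset.mul_sum]
  exact mul_le_mul_of_nonneg_left (sum_norm_le (blockK k y) φ') (by positivity)

/-- **`∂_{e′}(kernel vertex)` grows at most like `‖A′‖²(1 + Σ|φ′|²)²`** (explicit constant).
[cite: Balaban1983Higgs3, (1.4) p.412] -/
theorem abs_dKernelVertex_le {Ca : ℝ} (hCa0 : 0 ≤ Ca)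
    (hCa : ∀ (A' : (j : Fin k) → HiggsLattice.VecField P j) (x : HiggsLattice.Site P 0),
      |fluctContour D A' x| ≤ Ca * ‖A'‖)
    (ha : 0 ≤ D.a) (Ak : HiggsLattice.VecField P 0) (A' : (j : Fin k) → HiggsLattice.VecField P j)
    (φ : HiggsLattice.ScalarField P k N) (φΩ : ↥D.Ω → EuclideanSpace ℝ (Fin N)) (e : ℝ) :
    |dKernelVertex D Ak A' φ φΩ e|
      ≤ prec (B1.aSeq D.a P.L k) (P.mesh k) P.d * Fintype.card ↥D.Ωk
          * ((‖φ‖ + ((P.L : ℝ) ^ (k * P.d))⁻¹ * ((Fintype.card (HiggsLattice.Site P 0) : ℝ) + 1))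
              * (((P.L : ℝ) ^ (k * P.d))⁻¹ * (|D.C.e| * Ca) ^ 2 * ((Fintype.card (HiggsLattice.Site P 0) : ℝ) + 1))
            + (((P.L : ℝ) ^ (k * P.d))⁻¹ * (|D.C.e| * Ca) * ((Fintype.card (HiggsLattice.Site P 0) : ℝ) + 1)) ^ 2)
          * ‖A'‖ ^ 2 * (1 + sqSum (extendZero D.Ω φΩ)) ^ 2 := by
  set φ' := extendZero D.Ω φΩ with hφ'
  set S := sqSum φ' with hS
  set n₀ : ℝ := (Fintype.card (HiggsLattice.Site P 0) : ℝ) with hn₀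
  set Lk : ℝ := ((P.L : ℝ) ^ (k * P.d))⁻¹ with hLk
  set κ := prec (B1.aSeq D.a P.L k) (P.mesh k) P.d with hκ
  have hS0 : 0 ≤ S := sqSum_nonneg _
  have hn0 : 0 ≤ n₀ := by positivity
  have hLk0 : 0 ≤ Lk := by positivity
  have hκ0 : 0 ≤ κ := by
    rw [hκ]; unfold prec; exact mul_nonneg (D.aSeq_nonneg' ha k) (zpow_nonneg (P.mesh_pos k).le _)
  have hA0 := norm_nonneg A'
  have hy : ∀ y : ↥D.Ωk,
      |⟪φ y.1 - D.avgQ14 Ak e A' φ' y.1, d2AvgQ14 D Ak A' φ' e y.1⟫_ℝ - ‖dAvgQ14 D Ak A' φ' e y.1‖ ^ 2|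
        ≤ (‖φ‖ + Lk * (n₀ + S)) * (Lk * (|D.C.e| * Ca * ‖A'‖) ^ 2 * (n₀ + S))
          + (Lk * (|D.C.e| * Ca * ‖A'‖) * (n₀ + S)) ^ 2 := by
    intro y
    refine (abs_sub _ _).trans (add_le_add ?_ ?_)
    · exact (abs_real_inner_le_norm _ _).trans (mul_le_mul ((norm_sub_le _ _).trans (add_le_add
        (norm_le_pi_norm φ y.1) (norm_avgQ14_le D Ak e A' φ' y.1))) (norm_d2AvgQ14_le D hCa Ak A' φ' e y.1)
        (norm_nonneg _) (by positivity))
    · rw [abs_of_nonneg (sq_nonneg _)]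
      exact pow_le_pow_left₀ (norm_nonneg _) (norm_dAvgQ14_le D hCa0 hCa Ak A' φ' e y.1) 2
  rw [dKernelVertex_def, abs_neg, abs_mul, abs_of_nonneg hκ0]
  have hsum : |∑ y : ↥D.Ωk, (⟪φ y.1 - D.avgQ14 Ak e A' φ' y.1, d2AvgQ14 D Ak A' φ' e y.1⟫_ℝ
        - ‖dAvgQ14 D Ak A' φ' e y.1‖ ^ 2)|
      ≤ Fintype.card ↥D.Ωk * ((‖φ‖ + Lk * (n₀ + S)) * (Lk * (|D.C.e| * Ca * ‖A'‖) ^ 2 * (n₀ + S))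
          + (Lk * (|D.C.e| * Ca * ‖A'‖) * (n₀ + S)) ^ 2) := by
    refine (Finset.abs_sum_le_sum_abs _ _).trans ?_
    refine (Finset.sum_le_sum fun y _ => hy y).trans ?_
    rw [Finset.sum_const, Finset.card_univ, nsmul_eq_mul]
  refine (mul_le_mul_of_nonneg_left hsum hκ0).trans ?_
  have h1 : n₀ + S ≤ (n₀ + 1) * (1 + S) := by nlinarith
  have h2 : ‖φ‖ + Lk * (n₀ + S) ≤ (‖φ‖ + Lk * (n₀ + 1)) * (1 + S) := by
    have := mul_le_mul_of_nonneg_left h1 hLk0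
    nlinarith [norm_nonneg φ, mul_nonneg hLk0 hn0]
  have hQ0 : 0 ≤ Lk * (|D.C.e| * Ca * ‖A'‖) ^ 2 := by positivity
  have h3 : Lk * (|D.C.e| * Ca * ‖A'‖) ^ 2 * (n₀ + S) ≤ Lk * (|D.C.e| * Ca * ‖A'‖) ^ 2 * ((n₀ + 1) * (1 + S)) :=
    mul_le_mul_of_nonneg_left h1 hQ0
  have h4 : (‖φ‖ + Lk * (n₀ + S)) * (Lk * (|D.C.e| * Ca * ‖A'‖) ^ 2 * (n₀ + S))
      ≤ ((‖φ‖ + Lk * (n₀ + 1)) * (1 + S)) * (Lk * (|D.C.e| * Ca * ‖A'‖) ^ 2 * ((n₀ + 1) * (1 + S))) :=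
    mul_le_mul h2 h3 (by positivity) (by positivity)
  have h5 : Lk * (|D.C.e| * Ca * ‖A'‖) * (n₀ + S) ≤ Lk * (|D.C.e| * Ca * ‖A'‖) * ((n₀ + 1) * (1 + S)) :=
    mul_le_mul_of_nonneg_left h1 (by positivity)
  have h6 : (Lk * (|D.C.e| * Ca * ‖A'‖) * (n₀ + S)) ^ 2 ≤ (Lk * (|D.C.e| * Ca * ‖A'‖) * ((n₀ + 1) * (1 + S))) ^ 2 :=
    pow_le_pow_left₀ (by positivity) h5 2
  have hcard : (0 : ℝ) ≤ Fintype.card ↥D.Ωk := by positivity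
  calc κ * (Fintype.card ↥D.Ωk * ((‖φ‖ + Lk * (n₀ + S)) * (Lk * (|D.C.e| * Ca * ‖A'‖) ^ 2 * (n₀ + S))
          + (Lk * (|D.C.e| * Ca * ‖A'‖) * (n₀ + S)) ^ 2))
      ≤ κ * (Fintype.card ↥D.Ωk * (((‖φ‖ + Lk * (n₀ + 1)) * (1 + S)) * (Lk * (|D.C.e| * Ca * ‖A'‖) ^ 2
          * ((n₀ + 1) * (1 + S))) + (Lk * (|D.C.e| * Ca * ‖A'‖) * ((n₀ + 1) * (1 + S))) ^ 2)) :=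
        mul_le_mul_of_nonneg_left (mul_le_mul_of_nonneg_left (add_le_add h4 h6) hcard) hκ0
    _ = κ * Fintype.card ↥D.Ωk * ((‖φ‖ + Lk * (n₀ + 1)) * (Lk * (|D.C.e| * Ca) ^ 2 * (n₀ + 1))
          + (Lk * (|D.C.e| * Ca) * (n₀ + 1)) ^ 2) * ‖A'‖ ^ 2 * (1 + S) ^ 2 := by
        ring

/-- `|∂²_{e′}(D^η_𝒜φ′)(b)| ≤ η(eC_G‖A′‖)²|φ′(b₊)|`. [cite: Balaban1982Higgs1, (1.7) p.605] -/
theorem norm_d2CovDeriv_le {Cg : ℝ}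
    (hCg : ∀ (A' : (j : Fin k) → HiggsLattice.VecField P j) (b : HiggsLattice.PBond P 0),
      |fluctBond D A' b| ≤ Cg * ‖A'‖)
    (Ak : HiggsLattice.VecField P 0) (A' : (j : Fin k) → HiggsLattice.VecField P j)
    (φ' : HiggsLattice.ScalarField P 0 N) (e : ℝ) (b : HiggsLattice.PBond P 0) :
    ‖d2CovDeriv D Ak A' φ' e b‖ ≤ P.mesh 0 * (|D.C.e| * Cg * ‖A'‖) ^ 2 * ‖φ' b.tgt‖ := by
  have hη : 0 ≤ P.mesh 0 := (P.mesh_pos 0).le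
  rw [d2CovDeriv_def, norm_smul, Real.norm_of_nonneg (by positivity)]
  have h2 : ‖D.C.q (D.C.q (D.C.U (P.mesh 0) (D.extField Ak e A' b) (φ' b.tgt)))‖ ≤ ‖φ' b.tgt‖ :=
    (norm_q_apply_le D.C _).trans ((norm_q_apply_le D.C _).trans (B1Ineq233Upper.norm_U_apply D.C _ _ _).le)
  have hCg0 : 0 ≤ Cg * ‖A'‖ := (abs_nonneg _).trans (hCg A' b)
  refine mul_le_mul (mul_le_mul_of_nonneg_left ?_ hη) h2 (norm_nonneg _) (by positivity)
  rw [← sq_abs, abs_mul]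
  refine pow_le_pow_left₀ (by positivity) ?_ 2
  rw [mul_assoc]
  exact mul_le_mul_of_nonneg_left (hCg A' b) (abs_nonneg _)

/-- **`∂_{e′}(Dirichlet vertex)` grows at most like `‖A′‖²Σ|φ′|²`** (explicit constant).
[cite: Balaban1983Higgs3, (1.4) p.412] -/
theorem abs_dDirichletVertex_le {Cg : ℝ}
    (hCg : ∀ (A' : (j : Fin k) → HiggsLattice.VecField P j) (b : HiggsLattice.PBond P 0),
      |fluctBond D A' b| ≤ Cg * ‖A'‖)
    (Ak : HiggsLattice.VecField P 0) (A' : (j : Fin k) → HiggsLattice.VecField P j)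
    (φ' : HiggsLattice.ScalarField P 0 N) (e : ℝ) :
    |dDirichletVertex D Ak A' φ' e|
      ≤ Fintype.card (HiggsLattice.PBond P 0) * (P.mesh 0 ^ P.d * ((|D.C.e| * Cg * ‖A'‖) ^ 2 * (3 * sqSum φ'))) := by
  have hη0 : 0 < P.mesh 0 := P.mesh_pos 0
  have hηd : 0 ≤ P.mesh 0 ^ P.d := pow_nonneg hη0.le _
  have hQ0 : 0 ≤ (|D.C.e| * Cg * ‖A'‖) ^ 2 := sq_nonneg _
  have hb : ∀ b : HiggsLattice.PBond P 0,
      |(if Inside D.Ω b then P.mesh 0 ^ P.d * (⟪covDeriv D.C (D.extField Ak e A') φ' b, d2CovDeriv D Ak A' φ' e b⟫_ℝ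
        + ‖dCovDeriv D Ak A' φ' e b‖ ^ 2) else 0)|
        ≤ P.mesh 0 ^ P.d * ((|D.C.e| * Cg * ‖A'‖) ^ 2 * (3 * sqSum φ')) := by
    intro b
    have h1 := sq_le_sqSum φ' b.tgt
    have h2 := sq_le_sqSum φ' b.src
    have ht := norm_nonneg (φ' b.tgt)
    have hs := norm_nonneg (φ' b.src)
    have h3 : (‖φ' b.tgt‖ + ‖φ' b.src‖) * ‖φ' b.tgt‖ ≤ 2 * sqSum φ' := by
      nlinarith [sq_nonneg (‖φ' b.tgt‖ - ‖φ' b.src‖)]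
    have hinner : |⟪covDeriv D.C (D.extField Ak e A') φ' b, d2CovDeriv D Ak A' φ' e b⟫_ℝ|
        ≤ (|D.C.e| * Cg * ‖A'‖) ^ 2 * (2 * sqSum φ') := by
      refine (abs_real_inner_le_norm _ _).trans ?_
      refine (mul_le_mul (norm_covDeriv_le D.C _ φ' b) (norm_d2CovDeriv_le D hCg Ak A' φ' e b) (norm_nonneg _)
        (mul_nonneg (inv_nonneg.2 hη0.le) (by positivity))).trans ?_
      calc (P.mesh 0)⁻¹ * (‖φ' b.tgt‖ + ‖φ' b.src‖) * (P.mesh 0 * (|D.C.e| * Cg * ‖A'‖) ^ 2 * ‖φ' b.tgt‖)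
          = ((P.mesh 0)⁻¹ * P.mesh 0) * ((|D.C.e| * Cg * ‖A'‖) ^ 2 * ((‖φ' b.tgt‖ + ‖φ' b.src‖) * ‖φ' b.tgt‖)) := by
            ring
        _ = (|D.C.e| * Cg * ‖A'‖) ^ 2 * ((‖φ' b.tgt‖ + ‖φ' b.src‖) * ‖φ' b.tgt‖) := by
            rw [inv_mul_cancel₀ hη0.ne', one_mul]
        _ ≤ (|D.C.e| * Cg * ‖A'‖) ^ 2 * (2 * sqSum φ') := mul_le_mul_of_nonneg_left h3 hQ0
    have hsq : ‖dCovDeriv D Ak A' φ' e b‖ ^ 2 ≤ (|D.C.e| * Cg * ‖A'‖) ^ 2 * sqSum φ' := by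
      calc ‖dCovDeriv D Ak A' φ' e b‖ ^ 2 ≤ (|D.C.e| * Cg * ‖A'‖ * ‖φ' b.tgt‖) ^ 2 :=
            pow_le_pow_left₀ (norm_nonneg _) (norm_dCovDeriv_le D hCg Ak A' φ' e b) 2
        _ = (|D.C.e| * Cg * ‖A'‖) ^ 2 * ‖φ' b.tgt‖ ^ 2 := by ring
        _ ≤ (|D.C.e| * Cg * ‖A'‖) ^ 2 * sqSum φ' := mul_le_mul_of_nonneg_left h1 hQ0
    have hbound : |⟪covDeriv D.C (D.extField Ak e A') φ' b, d2CovDeriv D Ak A' φ' e b⟫_ℝ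
        + ‖dCovDeriv D Ak A' φ' e b‖ ^ 2| ≤ (|D.C.e| * Cg * ‖A'‖) ^ 2 * (3 * sqSum φ') := by
      refine (abs_add_le _ _).trans ?_
      rw [abs_of_nonneg (sq_nonneg ‖dCovDeriv D Ak A' φ' e b‖)]
      linarith [hinner, hsq]
    split_ifs
    · rw [abs_mul, abs_of_nonneg hηd]
      exact mul_le_mul_of_nonneg_left hbound hηd
    · rw [abs_zero]
      exact mul_nonneg hηd (mul_nonneg hQ0 (mul_nonneg zero_le_three (sqSum_nonneg _)))
  rw [dDirichletVertex_def]
  refine (Finset.abs_sum_le_sum_abs _ _).trans ((Finset.sum_le_sum fun b _ => hb b).trans ?_)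
  rw [Finset.sum_const, Finset.card_univ, nsmul_eq_mul]

/-- **`∂_{e′}(density vertex)` grows at most like `K‖A′‖²Σ|φ′|² + ½η^dB″_δ(L^kε)²Σ|φ′|² + B″_E`** given bounds
`B″_δ`, `B″_E` on the second `e′`-derivatives of the data at `(e′, λ′)`.
[cite: Balaban1983Higgs3, (1.4)–(1.7) pp.412–413] -/
theorem abs_dDensityVertex_le {Cg Bd Be : ℝ}
    (hCg : ∀ (A' : (j : Fin k) → HiggsLattice.VecField P j) (b : HiggsLattice.PBond P 0),
      |fluctBond D A' b| ≤ Cg * ‖A'‖)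
    (Ak : HiggsLattice.VecField P 0) (lam' : ℝ) (A' : (j : Fin k) → HiggsLattice.VecField P j)
    (φ' : HiggsLattice.ScalarField P 0 N) {e : ℝ} (hBd0 : 0 ≤ Bd)
    (hBd : ∀ x ∈ D.Ω₁, |deriv (deriv fun u => D.dm2 u lam' x) e| ≤ Bd)
    (hBe : |deriv (deriv fun u => D.E1 u lam') e| ≤ Be) :
    |dDensityVertex D Ak lam' A' φ' e|
      ≤ Fintype.card (HiggsLattice.PBond P 0) * (P.mesh 0 ^ P.d * ((|D.C.e| * Cg * ‖A'‖) ^ 2 * (3 * sqSum φ')))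
        + (1 / 2 : ℝ) * (P.mesh 0 ^ P.d * Bd * D.ell ^ 2 * sqSum φ') + Be := by
  have hηd : 0 ≤ P.mesh 0 ^ P.d := pow_nonneg (P.mesh_pos 0).le _
  rw [dDensityVertex_def]
  refine (abs_add_le _ _).trans (add_le_add ((abs_add_le _ _).trans (add_le_add
    (abs_dDirichletVertex_le D hCg Ak A' φ' e) ?_)) hBe)
  rw [abs_mul, abs_of_pos (by norm_num : (0 : ℝ) < 1 / 2)]
  refine mul_le_mul_of_nonneg_left ?_ (by norm_num)
  refine (Finset.abs_sum_le_sum_abs _ _).trans ?_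
  have hx : ∀ x ∈ D.Ω₁, |P.mesh 0 ^ P.d * deriv (deriv fun u => D.dm2 u lam' x) e * D.ell ^ 2 * ‖φ' x‖ ^ 2|
      ≤ P.mesh 0 ^ P.d * Bd * D.ell ^ 2 * ‖φ' x‖ ^ 2 := by
    intro x hx
    rw [abs_mul, abs_mul, abs_mul, abs_of_nonneg hηd, abs_of_nonneg (sq_nonneg D.ell),
      abs_of_nonneg (sq_nonneg ‖φ' x‖)]
    have := hBd x hx
    gcongr
  refine (Finset.sum_le_sum hx).trans ?_
  rw [← Finset.mul_sum]
  refine mul_le_mul_of_nonneg_left ?_ (by positivity)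
  unfold sqSum
  exact Finset.sum_le_sum_of_subset_of_nonneg (Finset.subset_univ _) fun x _ _ => sq_nonneg _

end SecondBounds

/-! ## 3. Uniform vertex bounds on a set of charges and one integrable majorant of `∂²_{e′}(t·exp[…])` -/

section SecondMajorant

variable {k : ℕ} (D : Data14 P N k)

/-- Integrability of an affine-times-Gaussian majorant `(J₀ + J₁‖A′‖)·M·Π_xe^{−c|φ′(x)|²}` against
`Π_j dμ_{C^{(j)}} ⊗ dφ′↾_Ω` (first moment of the family). [folklore] -/
private theorem integrable_affine_mul_gauss (hmsq : 0 < D.msq) (ha : 0 < D.a) (hL : 1 < (P.L : ℝ)) (hk : k ≤ P.K)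
    {J₀ J₁ M c : ℝ} (hJ₀ : 0 ≤ J₀) (hJ₁ : 0 ≤ J₁) (hM : 0 ≤ M) (hc : 0 < c) :
    Integrable (fun z : ((i : Fin k) → HiggsLattice.VecField P i) × (↥D.Ω → EuclideanSpace ℝ (Fin N)) =>
      (J₀ + J₁ * ‖z.1‖) * M * ∏ x, Real.exp (-c * ‖z.2 x‖ ^ 2)) ((fluctFamily P D.msq D.a k).prod volume) := by
  have h1 : Integrable (fun A' : (i : Fin k) → HiggsLattice.VecField P i => (J₀ + J₁ * ‖A'‖) * M)
      (fluctFamily P D.msq D.a k) := by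
    refine HiggsFluctMeasureExpMoments.integrable_of_polyGrowth_fluctFamily hmsq ha hL hk
      (((continuous_const.add (continuous_const.mul continuous_norm)).mul continuous_const).aestronglyMeasurable)
      (C := (J₀ + J₁) * M) (p := 1) fun A' => ?_
    rw [abs_of_nonneg (by positivity), pow_one]
    have hA := norm_nonneg A'
    have t1 := mul_nonneg (mul_nonneg hJ₀ hM) hA
    have t2 := mul_nonneg hJ₁ hM
    linarith
  exact h1.mul_prod (integrable_gauss_fibre D hc)

/-- Integrability of a quadratic-times-Gaussian majorant `(J₀ + J₂‖A′‖²)·M·Π_xe^{−c|φ′(x)|²}` (second moment of the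
family). [folklore] -/
private theorem integrable_quad_mul_gauss (hmsq : 0 < D.msq) (ha : 0 < D.a) (hL : 1 < (P.L : ℝ)) (hk : k ≤ P.K)
    {J₀ J₂ M c : ℝ} (hJ₀ : 0 ≤ J₀) (hJ₂ : 0 ≤ J₂) (hM : 0 ≤ M) (hc : 0 < c) :
    Integrable (fun z : ((i : Fin k) → HiggsLattice.VecField P i) × (↥D.Ω → EuclideanSpace ℝ (Fin N)) =>
      (J₀ + J₂ * ‖z.1‖ ^ 2) * M * ∏ x, Real.exp (-c * ‖z.2 x‖ ^ 2)) ((fluctFamily P D.msq D.a k).prod volume) := by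
  have h1 : Integrable (fun A' : (i : Fin k) → HiggsLattice.VecField P i => (J₀ + J₂ * ‖A'‖ ^ 2) * M)
      (fluctFamily P D.msq D.a k) := by
    refine HiggsFluctMeasureExpMoments.integrable_of_polyGrowth_fluctFamily hmsq ha hL hk
      (((continuous_const.add (continuous_const.mul (continuous_norm.pow 2))).mul
        continuous_const).aestronglyMeasurable)
      (C := (J₀ + J₂) * M) (p := 2) fun A' => ?_
    rw [abs_of_nonneg (by positivity)]
    have hA := norm_nonneg A'
    have hsq : ‖A'‖ ^ 2 ≤ (1 + ‖A'‖) ^ 2 := pow_le_pow_left₀ hA (le_add_of_nonneg_left zero_le_one) 2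
    have h1' : 1 ≤ (1 + ‖A'‖) ^ 2 := one_le_pow₀ (le_add_of_nonneg_right hA)
    have t1 := mul_le_mul_of_nonneg_left hsq (mul_nonneg hJ₂ hM)
    have t2 := mul_le_mul_of_nonneg_left h1' (mul_nonneg hJ₀ hM)
    linarith [t1, t2]
  exact h1.mul_prod (integrable_gauss_fibre D hc)

/-- **Uniform growth of the charge vertex**: `|charge vertex| ≤ (K₀ + K₁‖A′‖)(1 + Σ_x|φ′(x)|²)²` for all `e′` in a set
on which the first `e′`-derivatives of the data are bounded. [cite: Balaban1983Higgs3, (1.4)–(1.5) p.412] -/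
theorem exists_abs_chargeVertex_le (ha : 0 ≤ D.a) {lam' : ℝ} {I : Set ℝ} {Bd Be : ℝ} (hBd0 : 0 ≤ Bd) (hBe0 : 0 ≤ Be)
    (hBd : ∀ e ∈ I, ∀ x ∈ D.Ω₁, |deriv (fun u => D.dm2 u lam' x) e| ≤ Bd)
    (hBe : ∀ e ∈ I, |deriv (fun u => D.E1 u lam') e| ≤ Be)
    (Ak : HiggsLattice.VecField P 0) (φ : HiggsLattice.ScalarField P k N) :
    ∃ K₀ K₁ : ℝ, 0 ≤ K₀ ∧ 0 ≤ K₁ ∧ ∀ e ∈ I,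
      ∀ z : ((i : Fin k) → HiggsLattice.VecField P i) × (↥D.Ω → EuclideanSpace ℝ (Fin N)),
        |chargeVertex D lam' Ak φ e z| ≤ (K₀ + K₁ * ‖z.1‖) * (1 + sqSum (extendZero D.Ω z.2)) ^ 2 := by
  have hη1 : 0 < P.mesh 0 := P.mesh_pos 0
  obtain ⟨Ca, hCa0, hCa⟩ := exists_fluctContour_le D
  obtain ⟨Cg, hCg0, hCg⟩ := exists_fluctBond_le D
  have hκ0 : 0 ≤ prec (B1.aSeq D.a P.L k) (P.mesh k) P.d := by
    unfold prec; exact mul_nonneg (D.aSeq_nonneg' ha k) (zpow_nonneg (P.mesh_pos k).le _)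
  set A₁ : ℝ := prec (B1.aSeq D.a P.L k) (P.mesh k) P.d * Fintype.card ↥D.Ωk
      * ((‖φ‖ + ((P.L : ℝ) ^ (k * P.d))⁻¹ * ((Fintype.card (HiggsLattice.Site P 0) : ℝ) + 1))
        * (((P.L : ℝ) ^ (k * P.d))⁻¹ * (|D.C.e| * Ca) * ((Fintype.card (HiggsLattice.Site P 0) : ℝ) + 1)))
    with hA₁
  set A₂ : ℝ := Fintype.card (HiggsLattice.PBond P 0) * (P.mesh 0 ^ P.d * ((P.mesh 0)⁻¹ * (|D.C.e| * Cg))) with hA₂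
  have hA₁0 : 0 ≤ A₁ := by positivity
  have hA₂0 : 0 ≤ A₂ := by positivity
  have hW : 0 ≤ P.mesh 0 ^ P.d * Bd * D.ell ^ 2 := by positivity
  refine ⟨(1 / 2 : ℝ) * (P.mesh 0 ^ P.d * Bd * D.ell ^ 2) + Be, A₁ + A₂, by positivity, add_nonneg hA₁0 hA₂0,
    fun e he z => ?_⟩
  have hkv : |kernelVertex D Ak z.1 φ z.2 e|
      ≤ prec (B1.aSeq D.a P.L k) (P.mesh k) P.d * Fintype.card ↥D.Ωk
          * ((‖φ‖ + ((P.L : ℝ) ^ (k * P.d))⁻¹ * ((Fintype.card (HiggsLattice.Site P 0) : ℝ) + 1))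
            * (((P.L : ℝ) ^ (k * P.d))⁻¹ * (|D.C.e| * Ca * ‖z.1‖)
              * ((Fintype.card (HiggsLattice.Site P 0) : ℝ) + 1)))
          * (1 + sqSum (extendZero D.Ω z.2)) ^ 2 :=
    abs_kernelVertex_le D hCa0 hCa ha Ak z.1 φ z.2 e
  have hdv := abs_densityVertex_le D hCg Ak lam' z.1 (extendZero D.Ω z.2) hBd0 (hBd e he) (hBe e he)
  set S : ℝ := sqSum (extendZero D.Ω z.2) with hSdef
  have hS0 : 0 ≤ S := sqSum_nonneg _
  have h1S' : 1 ≤ 1 + S := le_add_of_nonneg_right hS0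
  have h1S : 1 ≤ (1 + S) ^ 2 := one_le_pow₀ h1S'
  have hSS : S ≤ (1 + S) ^ 2 :=
    (le_add_of_nonneg_left zero_le_one : S ≤ 1 + S).trans (le_self_pow₀ h1S' two_ne_zero)
  have h2S : 2 * S ≤ (1 + S) ^ 2 := by
    have e2 : (1 + S) ^ 2 = 2 * S + (1 + S ^ 2) := by ring
    rw [e2]
    exact le_add_of_nonneg_right (by positivity)
  have hA0 := norm_nonneg z.1
  rw [chargeVertex_def]
  refine (abs_add_le _ _).trans ?_
  have t0 := mul_le_mul_of_nonneg_left h2S (mul_nonneg hA₂0 hA0)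
  have t1 := mul_le_mul_of_nonneg_left hSS hW
  have t2 := mul_le_mul_of_nonneg_left h1S hBe0
  have ekv : prec (B1.aSeq D.a P.L k) (P.mesh k) P.d * Fintype.card ↥D.Ωk
      * ((‖φ‖ + ((P.L : ℝ) ^ (k * P.d))⁻¹ * ((Fintype.card (HiggsLattice.Site P 0) : ℝ) + 1))
        * (((P.L : ℝ) ^ (k * P.d))⁻¹ * (|D.C.e| * Ca * ‖z.1‖) * ((Fintype.card (HiggsLattice.Site P 0) : ℝ) + 1)))
      * (1 + S) ^ 2 = A₁ * ‖z.1‖ * (1 + S) ^ 2 := by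
    rw [hA₁]; ring
  have edv : Fintype.card (HiggsLattice.PBond P 0)
        * (P.mesh 0 ^ P.d * ((P.mesh 0)⁻¹ * (|D.C.e| * Cg * ‖z.1‖) * (2 * S))) = A₂ * ‖z.1‖ * (2 * S) := by
    rw [hA₂]; ring
  rw [ekv] at hkv
  rw [edv] at hdv
  linarith [hkv, hdv, t0, t1, t2]

/-- **Uniform growth of `∂_{e′}(charge vertex)`**: `|∂_{e′}(charge vertex)| ≤ (K₀′ + K₂′‖A′‖²)(1 + Σ_x|φ′(x)|²)²` for all
`e′` in a set on which the second `e′`-derivatives of the data are bounded. [cite: Balaban1983Higgs3, (1.4)–(1.5) p.412] -/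
theorem exists_abs_dChargeVertex_le (ha : 0 ≤ D.a) {lam' : ℝ} {I : Set ℝ} {Bd Be : ℝ} (hBd0 : 0 ≤ Bd)
    (hBe0 : 0 ≤ Be) (hBd : ∀ e ∈ I, ∀ x ∈ D.Ω₁, |deriv (deriv fun u => D.dm2 u lam' x) e| ≤ Bd)
    (hBe : ∀ e ∈ I, |deriv (deriv fun u => D.E1 u lam') e| ≤ Be)
    (Ak : HiggsLattice.VecField P 0) (φ : HiggsLattice.ScalarField P k N) :
    ∃ K₀ K₂ : ℝ, 0 ≤ K₀ ∧ 0 ≤ K₂ ∧ ∀ e ∈ I,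
      ∀ z : ((i : Fin k) → HiggsLattice.VecField P i) × (↥D.Ω → EuclideanSpace ℝ (Fin N)),
        |dChargeVertex D lam' Ak φ e z| ≤ (K₀ + K₂ * ‖z.1‖ ^ 2) * (1 + sqSum (extendZero D.Ω z.2)) ^ 2 := by
  have hη1 : 0 < P.mesh 0 := P.mesh_pos 0
  obtain ⟨Ca, hCa0, hCa⟩ := exists_fluctContour_le D
  obtain ⟨Cg, hCg0, hCg⟩ := exists_fluctBond_le D
  have hκ0 : 0 ≤ prec (B1.aSeq D.a P.L k) (P.mesh k) P.d := by
    unfold prec; exact mul_nonneg (D.aSeq_nonneg' ha k) (zpow_nonneg (P.mesh_pos k).le _)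
  set A₃ : ℝ := prec (B1.aSeq D.a P.L k) (P.mesh k) P.d * Fintype.card ↥D.Ωk
      * ((‖φ‖ + ((P.L : ℝ) ^ (k * P.d))⁻¹ * ((Fintype.card (HiggsLattice.Site P 0) : ℝ) + 1))
          * (((P.L : ℝ) ^ (k * P.d))⁻¹ * (|D.C.e| * Ca) ^ 2 * ((Fintype.card (HiggsLattice.Site P 0) : ℝ) + 1))
        + (((P.L : ℝ) ^ (k * P.d))⁻¹ * (|D.C.e| * Ca) * ((Fintype.card (HiggsLattice.Site P 0) : ℝ) + 1)) ^ 2)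
    with hA₃
  set A₄ : ℝ := Fintype.card (HiggsLattice.PBond P 0) * (P.mesh 0 ^ P.d * ((|D.C.e| * Cg) ^ 2 * 3)) with hA₄
  have hA₃0 : 0 ≤ A₃ := by positivity
  have hA₄0 : 0 ≤ A₄ := by positivity
  have hW : 0 ≤ P.mesh 0 ^ P.d * Bd * D.ell ^ 2 := by positivity
  refine ⟨(1 / 2 : ℝ) * (P.mesh 0 ^ P.d * Bd * D.ell ^ 2) + Be, A₃ + A₄, by positivity, add_nonneg hA₃0 hA₄0,
    fun e he z => ?_⟩
  have hkv : |dKernelVertex D Ak z.1 φ z.2 e| ≤ A₃ * ‖z.1‖ ^ 2 * (1 + sqSum (extendZero D.Ω z.2)) ^ 2 :=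
    abs_dKernelVertex_le D hCa0 hCa ha Ak z.1 φ z.2 e
  have hdv := abs_dDensityVertex_le D hCg Ak lam' z.1 (extendZero D.Ω z.2) hBd0 (hBd e he) (hBe e he)
  set S : ℝ := sqSum (extendZero D.Ω z.2) with hSdef
  have hS0 : 0 ≤ S := sqSum_nonneg _
  have h1S' : 1 ≤ 1 + S := le_add_of_nonneg_right hS0
  have h1S : 1 ≤ (1 + S) ^ 2 := one_le_pow₀ h1S'
  have hSS : S ≤ (1 + S) ^ 2 :=
    (le_add_of_nonneg_left zero_le_one : S ≤ 1 + S).trans (le_self_pow₀ h1S' two_ne_zero)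
  have hA0 := norm_nonneg z.1
  rw [dChargeVertex_def]
  refine (abs_add_le _ _).trans ?_
  have t0 := mul_le_mul_of_nonneg_left hSS (mul_nonneg hA₄0 (sq_nonneg ‖z.1‖))
  have t1 := mul_le_mul_of_nonneg_left hSS hW
  have t2 := mul_le_mul_of_nonneg_left h1S hBe0
  have edv : Fintype.card (HiggsLattice.PBond P 0) * (P.mesh 0 ^ P.d * ((|D.C.e| * Cg * ‖z.1‖) ^ 2 * (3 * S)))
      = A₄ * ‖z.1‖ ^ 2 * S := by
    rw [hA₄]; ring
  rw [edv] at hdv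
  linarith [hkv, hdv, t0, t1, t2]

/-- **Uniform Gaussian domination of `t·exp[…]` on a set of charges**: `0 ≤ t·exp[…] ≤ M·e^{−2cΣ_x|φ′(x)|²}`,
`c = m₀(L^kε)²η^d/4`, for all `e′` with renormalized mass `≥ m₀` on `Ω₁` and `|E₁(e′,λ′)| ≤ K_E`
(`B3Eq14Finite.kernel14_le`, `B3Eq14Finite.density14_le_explicit`). [cite: Balaban1983Higgs3, (1.4) p.412] -/
theorem exists_fibre14_le_exp (ha : 0 ≤ D.a) (hℓ : D.ell ≠ 0) {lam' : ℝ} (hq : 0 ≤ lam' * D.lamRun) {I : Set ℝ}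
    {m₀ KE : ℝ} (hm₀ : 0 < m₀) (hm₀m : m₀ ≤ D.m2) (hmass : ∀ e ∈ I, ∀ x ∈ D.Ω₁, m₀ ≤ D.m2 + D.dm2 e lam' x)
    (hKE : ∀ e ∈ I, |D.E1 e lam'| ≤ KE) (Ak : HiggsLattice.VecField P 0) (φ : HiggsLattice.ScalarField P k N) :
    ∃ M : ℝ, 0 ≤ M ∧ ∀ e ∈ I,
      ∀ z : ((i : Fin k) → HiggsLattice.VecField P i) × (↥D.Ω → EuclideanSpace ℝ (Fin N)),
        0 ≤ D.kernel14 Ak e z.1 φ z.2 * D.density14 Ak e lam' z.1 (extendZero D.Ω z.2) ∧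
        D.kernel14 Ak e z.1 φ z.2 * D.density14 Ak e lam' z.1 (extendZero D.Ω z.2)
          ≤ M * Real.exp (-(2 * (m₀ * D.ell ^ 2 * P.mesh 0 ^ P.d / 4)) * sqSum (extendZero D.Ω z.2)) := by
  set κ : ℝ := prec (B1.aSeq D.a P.L k) (P.mesh k) P.d with hκdef
  have hκ0 : 0 ≤ κ := by
    rw [hκdef]; unfold prec; exact mul_nonneg (D.aSeq_nonneg' ha k) (zpow_nonneg (P.mesh_pos k).le _)
  set Cκ : ℝ := ((κ / (2 * Real.pi)) ^ ((Module.finrank ℝ (EuclideanSpace ℝ (Fin N)) : ℝ) / 2))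
      ^ Fintype.card ↥D.Ωk with hCκ
  have hCκ0 : 0 ≤ Cκ := pow_nonneg (Real.rpow_nonneg (by positivity) _) _
  refine ⟨Cκ * Real.exp KE, by positivity, fun e he z => ?_⟩
  have hkern : D.kernel14 Ak e z.1 φ z.2 ≤ Cκ := kernel14_le D ha Ak e z.1 φ z.2
  have hkern0 : 0 ≤ D.kernel14 Ak e z.1 φ z.2 := D.kernel14_nonneg ha Ak e z.1 φ z.2
  have hdens := density14_le_explicit D hℓ hm₀ hm₀m (hmass e he) hq Ak z.1 (extendZero D.Ω z.2)
  have hdens0 : 0 ≤ D.density14 Ak e lam' z.1 (extendZero D.Ω z.2) :=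
    (D.density14_pos Ak e lam' z.1 (extendZero D.Ω z.2)).le
  refine ⟨mul_nonneg hkern0 hdens0, ?_⟩
  have e3 : -D.E1 e lam' - m₀ * D.ell ^ 2 * P.mesh 0 ^ P.d / 2 * sqSum (extendZero D.Ω z.2)
      = -D.E1 e lam' + -(2 * (m₀ * D.ell ^ 2 * P.mesh 0 ^ P.d / 4)) * sqSum (extendZero D.Ω z.2) := by ring
  rw [e3, Real.exp_add] at hdens
  have h2 : Real.exp (-D.E1 e lam') ≤ Real.exp KE :=
    Real.exp_le_exp.2 ((neg_le_abs (D.E1 e lam')).trans (hKE e he))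
  calc D.kernel14 Ak e z.1 φ z.2 * D.density14 Ak e lam' z.1 (extendZero D.Ω z.2)
      ≤ Cκ * (Real.exp (-D.E1 e lam')
          * Real.exp (-(2 * (m₀ * D.ell ^ 2 * P.mesh 0 ^ P.d / 4)) * sqSum (extendZero D.Ω z.2))) :=
        mul_le_mul hkern hdens hdens0 hCκ0
    _ ≤ Cκ * (Real.exp KE * Real.exp (-(2 * (m₀ * D.ell ^ 2 * P.mesh 0 ^ P.d / 4)) * sqSum (extendZero D.Ω z.2))) :=
        mul_le_mul_of_nonneg_left (mul_le_mul_of_nonneg_right h2 (Real.exp_pos _).le) hCκ0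
    _ = Cκ * Real.exp KE * Real.exp (-(2 * (m₀ * D.ell ^ 2 * P.mesh 0 ^ P.d / 4)) * sqSum (extendZero D.Ω z.2)) := by
        ring

/-- `(1+S)⁴e^{−2cS} ≤ 24c⁻⁴e^{c}·e^{−cS}` for `S ≥ 0 < c`. [folklore] -/
private theorem one_add_pow_four_mul_exp_le {c S : ℝ} (hc : 0 < c) (hS : 0 ≤ S) :
    (1 + S) ^ 4 * Real.exp (-(2 * c) * S) ≤ (24 * (c⁻¹) ^ 4 * Real.exp c) * Real.exp (-c * S) := by
  have h := Real.pow_div_factorial_le_exp (c * (1 + S)) (by positivity) 4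
  have hf : ((Nat.factorial 4 : ℕ) : ℝ) = 24 := by norm_num [Nat.factorial]
  rw [hf, div_le_iff₀ (by norm_num : (0 : ℝ) < 24), mul_pow] at h
  have hc4 : 0 < c ^ 4 := pow_pos hc 4
  have h1 : (1 + S) ^ 4 ≤ 24 * (c⁻¹) ^ 4 * Real.exp (c * (1 + S)) := by
    calc (1 + S) ^ 4 = (c⁻¹) ^ 4 * (c ^ 4 * (1 + S) ^ 4) := by field_simp
      _ ≤ (c⁻¹) ^ 4 * (Real.exp (c * (1 + S)) * 24) := mul_le_mul_of_nonneg_left h (by positivity)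
      _ = 24 * (c⁻¹) ^ 4 * Real.exp (c * (1 + S)) := by ring
  have e4 : Real.exp (c * (1 + S)) * Real.exp (-(2 * c) * S) = Real.exp c * Real.exp (-c * S) := by
    rw [← Real.exp_add, ← Real.exp_add]
    congr 1
    ring
  calc (1 + S) ^ 4 * Real.exp (-(2 * c) * S)
      ≤ (24 * (c⁻¹) ^ 4 * Real.exp (c * (1 + S))) * Real.exp (-(2 * c) * S) :=
        mul_le_mul_of_nonneg_right h1 (Real.exp_pos _).le
    _ = 24 * (c⁻¹) ^ 4 * (Real.exp (c * (1 + S)) * Real.exp (-(2 * c) * S)) := by ring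
    _ = (24 * (c⁻¹) ^ 4 * Real.exp c) * Real.exp (-c * S) := by rw [e4]; ring

/-- **ONE INTEGRABLE MAJORANT of the two pieces `(charge vertex)²·t·exp[…]` and `∂_{e′}(charge vertex)·t·exp[…]` of
`∂²_{e′}(t·exp[…])`, uniform in `e′ ∈ [e′₀−ρ, e′₀+ρ]`**: `(J₀ + J₂‖A′‖²)·M·Π_{x∈Ω}e^{−c|φ′(x)|²}`, integrable against
`Π_j dμ_{C^{(j)}} ⊗ dφ′↾_Ω` by the SECOND MOMENT of the fluctuation family
(`HiggsFluctMeasureExpMoments.integrable_of_polyGrowth_fluctFamily`) times the Gaussian fibre.  Hypotheses: those of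
`exists_chargeDeriv_majorant` with data `δm²(·,λ′,x)`, `E₁(·,λ′)` of class `C²` in `e′`.
[cite: Balaban1983Higgs3, (1.4)–(1.5) p.412] -/
theorem exists_chargeDeriv2_majorant (hmsq : 0 < D.msq) (ha : 0 < D.a) (hL : 1 < (P.L : ℝ)) (hk : k ≤ P.K)
    (hℓ : D.ell ≠ 0) {lam' : ℝ} (hq : 0 ≤ lam' * D.lamRun) {e₀ ρ m₀ : ℝ} (hm₀ : 0 < m₀) (hm₀m : m₀ ≤ D.m2)
    (hmass : ∀ e ∈ Set.Icc (e₀ - ρ) (e₀ + ρ), ∀ x ∈ D.Ω₁, m₀ ≤ D.m2 + D.dm2 e lam' x)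
    (hdm2 : ∀ x ∈ D.Ω₁, ContDiff ℝ 2 (fun e => D.dm2 e lam' x)) (hE1 : ContDiff ℝ 2 (fun e => D.E1 e lam'))
    (Ak : HiggsLattice.VecField P 0) (φ : HiggsLattice.ScalarField P k N) :
    ∃ bound : ((i : Fin k) → HiggsLattice.VecField P i) × (↥D.Ω → EuclideanSpace ℝ (Fin N)) → ℝ,
      Integrable bound ((fluctFamily P D.msq D.a k).prod volume) ∧
      ∀ e ∈ Set.Icc (e₀ - ρ) (e₀ + ρ),
        ∀ z : ((i : Fin k) → HiggsLattice.VecField P i) × (↥D.Ω → EuclideanSpace ℝ (Fin N)),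
          chargeVertex D lam' Ak φ e z ^ 2
              * (D.kernel14 Ak e z.1 φ z.2 * D.density14 Ak e lam' z.1 (extendZero D.Ω z.2)) ≤ bound z ∧
          |dChargeVertex D lam' Ak φ e z
              * (D.kernel14 Ak e z.1 φ z.2 * D.density14 Ak e lam' z.1 (extendZero D.Ω z.2))| ≤ bound z := by
  haveI := HiggsFluctMeasurePos.fluctFamily_isProbability (P := P) hmsq ha hL hk
  have hη1 : 0 < P.mesh 0 := P.mesh_pos 0
  set I : Set ℝ := Set.Icc (e₀ - ρ) (e₀ + ρ) with hI
  -- uniform bounds of the data and their first two `e′`-derivatives on the interval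
  have hd1 : ∀ x ∈ D.Ω₁, ContDiff ℝ 1 (deriv fun e => D.dm2 e lam' x) := fun x hx =>
    ((contDiff_succ_iff_deriv (n := 1)).1 (hdm2 x hx)).2.2
  have hE1d : ContDiff ℝ 1 (deriv fun e => D.E1 e lam') := ((contDiff_succ_iff_deriv (n := 1)).1 hE1).2.2
  have hBdx : ∀ x : HiggsLattice.Site P 0, ∃ B : ℝ, 0 ≤ B ∧ (x ∈ D.Ω₁ → ∀ e ∈ I,
      |deriv (fun u => D.dm2 u lam' x) e| ≤ B ∧ |deriv (deriv fun u => D.dm2 u lam' x) e| ≤ B) := by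
    intro x
    by_cases hx : x ∈ D.Ω₁
    · obtain ⟨B₁, hB₁0, hB₁⟩ :=
        exists_abs_le_of_continuous ((hdm2 x hx).continuous_deriv (by norm_num)) (e₀ - ρ) (e₀ + ρ)
      obtain ⟨B₂, hB₂0, hB₂⟩ := exists_abs_le_of_continuous ((hd1 x hx).continuous_deriv le_rfl) (e₀ - ρ) (e₀ + ρ)
      exact ⟨max B₁ B₂, le_max_of_le_left hB₁0, fun _ e he =>
        ⟨(hB₁ e he).trans (le_max_left _ _), (hB₂ e he).trans (le_max_right _ _)⟩⟩
    · exact ⟨0, le_rfl, fun h => absurd h hx⟩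
  choose B hB0 hB using hBdx
  have hBd0 : 0 ≤ ∑ x, B x := Finset.sum_nonneg fun x _ => hB0 x
  have hBx : ∀ x, B x ≤ ∑ y, B y := fun x => Finset.single_le_sum (fun y _ => hB0 y) (Finset.mem_univ x)
  have hBd1 : ∀ e ∈ I, ∀ x ∈ D.Ω₁, |deriv (fun u => D.dm2 u lam' x) e| ≤ ∑ x, B x :=
    fun e he x hx => ((hB x hx e he).1).trans (hBx x)
  have hBd2 : ∀ e ∈ I, ∀ x ∈ D.Ω₁, |deriv (deriv fun u => D.dm2 u lam' x) e| ≤ ∑ x, B x :=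
    fun e he x hx => ((hB x hx e he).2).trans (hBx x)
  obtain ⟨Be, hBe0, hBe⟩ := exists_abs_le_of_continuous (hE1.continuous_deriv (by norm_num)) (e₀ - ρ) (e₀ + ρ)
  obtain ⟨Be2, hBe20, hBe2⟩ := exists_abs_le_of_continuous (hE1d.continuous_deriv le_rfl) (e₀ - ρ) (e₀ + ρ)
  obtain ⟨KE, -, hKE⟩ := exists_abs_le_of_continuous hE1.continuous (e₀ - ρ) (e₀ + ρ)
  -- the three uniform bounds
  obtain ⟨K₀, K₁, hK₀0, hK₁0, hcv⟩ := exists_abs_chargeVertex_le D ha.le hBd0 hBe0 hBd1 hBe Ak φ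
  obtain ⟨K₀', K₂', hK₀'0, hK₂'0, hdcv⟩ := exists_abs_dChargeVertex_le D ha.le hBd0 hBe20 hBd2 hBe2 Ak φ
  obtain ⟨M, hM0, hF⟩ := exists_fibre14_le_exp D ha.le hℓ hq hm₀ hm₀m hmass hKE Ak φ
  set c : ℝ := m₀ * D.ell ^ 2 * P.mesh 0 ^ P.d / 4 with hcdef
  have hℓ2 : 0 < D.ell ^ 2 := by positivity
  have hc : 0 < c := by positivity
  set J₀ : ℝ := 2 * K₀ ^ 2 + K₀' with hJ₀
  set J₂ : ℝ := 2 * K₁ ^ 2 + K₂' with hJ₂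
  have hJ₀0 : 0 ≤ J₀ := by positivity
  have hJ₂0 : 0 ≤ J₂ := by positivity
  set M' : ℝ := M * (24 * (c⁻¹) ^ 4 * Real.exp c) with hM'
  have hM'0 : 0 ≤ M' := by positivity
  refine ⟨fun z => (J₀ + J₂ * ‖z.1‖ ^ 2) * M' * ∏ x, Real.exp (-c * ‖z.2 x‖ ^ 2), ?_, fun e he z => ?_⟩
  · exact integrable_quad_mul_gauss D hmsq ha hL hk hJ₀0 hJ₂0 hM'0 hc
  · dsimp only
    obtain ⟨hF0, hFle⟩ := hF e he z
    have hcvz := hcv e he z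
    have hdcvz := hdcv e he z
    set S : ℝ := sqSum (extendZero D.Ω z.2) with hSdef
    have hS0 : 0 ≤ S := sqSum_nonneg _
    have hS : S = ∑ x, ‖z.2 x‖ ^ 2 := sqSum_extendZero D.Ω z.2
    set F := D.kernel14 Ak e z.1 φ z.2 * D.density14 Ak e lam' z.1 (extendZero D.Ω z.2) with hFdef
    have hA0 := norm_nonneg z.1
    have h1S : 1 ≤ (1 + S) ^ 2 := one_le_pow₀ (le_add_of_nonneg_right hS0)
    have h24 : (1 + S) ^ 2 ≤ (1 + S) ^ 4 := by
      calc (1 + S) ^ 2 = (1 + S) ^ 2 * 1 := (mul_one _).symm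
        _ ≤ (1 + S) ^ 2 * (1 + S) ^ 2 := mul_le_mul_of_nonneg_left h1S (by positivity)
        _ = (1 + S) ^ 4 := by ring
    have hexp := one_add_pow_four_mul_exp_le hc hS0
    have egauss : Real.exp (-c * S) = ∏ x, Real.exp (-c * ‖z.2 x‖ ^ 2) := by
      rw [← Real.exp_sum, hS, Finset.mul_sum]
    have hFle' : F ≤ M * Real.exp (-(2 * c) * S) := hFle
    -- common tail: `X·(1+S)⁴·F ≤ X·M'·Π` for `X ≥ 0`
    have tail : ∀ X : ℝ, 0 ≤ X → X * (1 + S) ^ 4 * F ≤ X * M' * ∏ x, Real.exp (-c * ‖z.2 x‖ ^ 2) := by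
      intro X hX
      rw [← egauss, hM']
      calc X * (1 + S) ^ 4 * F ≤ X * (1 + S) ^ 4 * (M * Real.exp (-(2 * c) * S)) :=
            mul_le_mul_of_nonneg_left hFle' (by positivity)
        _ = X * M * ((1 + S) ^ 4 * Real.exp (-(2 * c) * S)) := by ring
        _ ≤ X * M * ((24 * (c⁻¹) ^ 4 * Real.exp c) * Real.exp (-c * S)) :=
            mul_le_mul_of_nonneg_left hexp (by positivity)
        _ = X * (M * (24 * (c⁻¹) ^ 4 * Real.exp c)) * Real.exp (-c * S) := by ring
    have hJ : 0 ≤ J₀ + J₂ * ‖z.1‖ ^ 2 := by positivity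
    refine ⟨?_, ?_⟩
    · -- `(cv)²·F ≤ 2(K₀² + K₁²‖A′‖²)(1+S)⁴·F ≤ bound`
      have hsq : chargeVertex D lam' Ak φ e z ^ 2 ≤ ((K₀ + K₁ * ‖z.1‖) * (1 + S) ^ 2) ^ 2 := by
        rw [← sq_abs (chargeVertex D lam' Ak φ e z)]
        exact pow_le_pow_left₀ (abs_nonneg _) hcvz 2
      have hKK : (K₀ + K₁ * ‖z.1‖) ^ 2 ≤ 2 * K₀ ^ 2 + 2 * K₁ ^ 2 * ‖z.1‖ ^ 2 := by
        linarith [sq_nonneg (K₀ - K₁ * ‖z.1‖)]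
      have hle : 2 * K₀ ^ 2 + 2 * K₁ ^ 2 * ‖z.1‖ ^ 2 ≤ J₀ + J₂ * ‖z.1‖ ^ 2 := by
        rw [hJ₀, hJ₂]; linarith [mul_nonneg hK₂'0 (sq_nonneg ‖z.1‖)]
      calc chargeVertex D lam' Ak φ e z ^ 2 * F ≤ ((K₀ + K₁ * ‖z.1‖) * (1 + S) ^ 2) ^ 2 * F :=
            mul_le_mul_of_nonneg_right hsq hF0
        _ = (K₀ + K₁ * ‖z.1‖) ^ 2 * (1 + S) ^ 4 * F := by ring
        _ ≤ (J₀ + J₂ * ‖z.1‖ ^ 2) * (1 + S) ^ 4 * F :=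
            mul_le_mul_of_nonneg_right (mul_le_mul_of_nonneg_right (hKK.trans hle) (by positivity)) hF0
        _ ≤ (J₀ + J₂ * ‖z.1‖ ^ 2) * M' * ∏ x, Real.exp (-c * ‖z.2 x‖ ^ 2) := tail _ hJ
    · -- `|∂cv|·F ≤ (K₀′ + K₂′‖A′‖²)(1+S)²·F ≤ bound`
      have hle : K₀' + K₂' * ‖z.1‖ ^ 2 ≤ J₀ + J₂ * ‖z.1‖ ^ 2 := by
        rw [hJ₀, hJ₂]; linarith [sq_nonneg K₀, mul_nonneg (sq_nonneg K₁) (sq_nonneg ‖z.1‖)]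
      have hK' : 0 ≤ K₀' + K₂' * ‖z.1‖ ^ 2 := by positivity
      rw [abs_mul, abs_of_nonneg hF0]
      calc |dChargeVertex D lam' Ak φ e z| * F ≤ (K₀' + K₂' * ‖z.1‖ ^ 2) * (1 + S) ^ 2 * F :=
            mul_le_mul_of_nonneg_right hdcvz hF0
        _ ≤ (K₀' + K₂' * ‖z.1‖ ^ 2) * (1 + S) ^ 4 * F :=
            mul_le_mul_of_nonneg_right (mul_le_mul_of_nonneg_left h24 hK') hF0
        _ ≤ (J₀ + J₂ * ‖z.1‖ ^ 2) * (1 + S) ^ 4 * F :=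
            mul_le_mul_of_nonneg_right (mul_le_mul_of_nonneg_right hle (by positivity)) hF0
        _ ≤ (J₀ + J₂ * ‖z.1‖ ^ 2) * M' * ∏ x, Real.exp (-c * ‖z.2 x‖ ^ 2) := tail _ hJ

end SecondMajorant

/-! ## 4. `∂²_{e′}exp(−E_k)` and `∂²_{e′}E_k = ⟨∂_{e′}(charge vertex)⟩ − Var(charge vertex)` -/

section SecondChargeDerivative

variable {k : ℕ} (D : Data14 P N k)

/-- The Gaussian kernel `t(Ω;φ,φ′)` of (1.4) is strictly positive (`a_k(L^kη)^{d−2} > 0`).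
[cite: Balaban1983Higgs3, (1.4) p.412] -/
theorem kernel14_pos (ha : 0 < D.a) (hL : 1 < (P.L : ℝ)) (hk1 : 1 ≤ k) (Ak : HiggsLattice.VecField P 0) (e : ℝ)
    (A' : (j : Fin k) → HiggsLattice.VecField P j) (φ : HiggsLattice.ScalarField P k N)
    (φΩ : ↥D.Ω → EuclideanSpace ℝ (Fin N)) : 0 < D.kernel14 Ak e A' φ φΩ := by
  rw [Data14.kernel14_eq]
  exact Finset.prod_pos fun y _ => rtKernel_pos (prec_pos D ha hL hk1) _

/-- The charge vertex `e′ ↦ (charge vertex)(e′, z)` is measurable on the product space for every `e′`: it is the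
`e′`-derivative of `−log(t·exp[…])`, a pointwise limit of measurable difference quotients.
[cite: Balaban1983Higgs3, (1.4)–(1.5) p.412] -/
theorem aestronglyMeasurable_chargeVertex (ha : 0 < D.a) (hL : 1 < (P.L : ℝ)) (hk1 : 1 ≤ k) {lam' : ℝ}
    {e : ℝ} (hdm2 : ∀ x ∈ D.Ω₁, DifferentiableAt ℝ (fun u => D.dm2 u lam' x) e)
    (hE1 : DifferentiableAt ℝ (fun u => D.E1 u lam') e) (Ak : HiggsLattice.VecField P 0)
    (φ : HiggsLattice.ScalarField P k N)
    (ν : Measure (((i : Fin k) → HiggsLattice.VecField P i) × (↥D.Ω → EuclideanSpace ℝ (Fin N)))) :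
    AEStronglyMeasurable (fun z => chargeVertex D lam' Ak φ e z) ν := by
  have hF_cont : ∀ u, Continuous fun z : ((i : Fin k) → HiggsLattice.VecField P i) × (↥D.Ω → EuclideanSpace ℝ (Fin N)) =>
      D.kernel14 Ak u z.1 φ z.2 * D.density14 Ak u lam' z.1 (extendZero D.Ω z.2) := fun u =>
    continuous_fibre14₄ D u lam' continuous_const continuous_fst continuous_const continuous_snd
  have hpos : ∀ u (z : ((i : Fin k) → HiggsLattice.VecField P i) × (↥D.Ω → EuclideanSpace ℝ (Fin N))),
      0 < D.kernel14 Ak u z.1 φ z.2 * D.density14 Ak u lam' z.1 (extendZero D.Ω z.2) := fun u z =>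
    mul_pos (kernel14_pos D ha hL hk1 Ak u z.1 φ z.2) (D.density14_pos Ak u lam' z.1 (extendZero D.Ω z.2))
  have hlog : ∀ u, AEStronglyMeasurable (fun z : ((i : Fin k) → HiggsLattice.VecField P i)
      × (↥D.Ω → EuclideanSpace ℝ (Fin N)) =>
      -Real.log (D.kernel14 Ak u z.1 φ z.2 * D.density14 Ak u lam' z.1 (extendZero D.Ω z.2))) ν := fun u =>
    (Real.measurable_log.comp_aemeasurable (hF_cont u).aemeasurable).aestronglyMeasurable.neg
  refine aestronglyMeasurable_of_hasDerivAt_param (e₀ := e) hlog fun z => ?_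
  have h := ((hasDerivAt_fibre14_charge D lam' Ak φ z hdm2 hE1).log (hpos e z).ne').neg
  refine h.congr_deriv ?_
  rw [neg_mul, neg_div, neg_neg, mul_div_assoc, div_self (hpos e z).ne', mul_one]

/-- **THE `e′`-DERIVATIVE OF `∫∫(charge vertex)·t·exp[…]` EXISTS** (two-sided, at `e′₀`) and equals
`−∫∫((charge vertex)² − ∂_{e′}(charge vertex))·t·exp[…]`: dominated differentiation with the majorant
`exists_chargeDeriv2_majorant` (data of class `C²` in `e′`). [cite: Balaban1983Higgs3, (1.4)–(1.5) p.412] -/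
theorem hasDerivAt_integral_chargeVertex_mul (hmsq : 0 < D.msq) (ha : 0 < D.a) (hL : 1 < (P.L : ℝ)) (hk1 : 1 ≤ k)
    (hk : k ≤ P.K) (hℓ : D.ell ≠ 0) {lam' : ℝ} (hq : 0 ≤ lam' * D.lamRun) {e₀ ρ m₀ : ℝ} (hρ : 0 < ρ)
    (hm₀ : 0 < m₀) (hm₀m : m₀ ≤ D.m2)
    (hmass : ∀ e ∈ Set.Icc (e₀ - ρ) (e₀ + ρ), ∀ x ∈ D.Ω₁, m₀ ≤ D.m2 + D.dm2 e lam' x)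
    (hdm2 : ∀ x ∈ D.Ω₁, ContDiff ℝ 2 (fun e => D.dm2 e lam' x)) (hE1 : ContDiff ℝ 2 (fun e => D.E1 e lam'))
    (Ak : HiggsLattice.VecField P 0) (φ : HiggsLattice.ScalarField P k N) :
    HasDerivAt (fun e => ∫ z, chargeVertex D lam' Ak φ e z
        * (D.kernel14 Ak e z.1 φ z.2 * D.density14 Ak e lam' z.1 (extendZero D.Ω z.2))
        ∂((fluctFamily P D.msq D.a k).prod volume))
      (-(∫ z, (chargeVertex D lam' Ak φ e₀ z ^ 2 - dChargeVertex D lam' Ak φ e₀ z)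
          * (D.kernel14 Ak e₀ z.1 φ z.2 * D.density14 Ak e₀ lam' z.1 (extendZero D.Ω z.2))
          ∂((fluctFamily P D.msq D.a k).prod volume))) e₀ := by
  haveI := HiggsFluctMeasurePos.fluctFamily_isProbability (P := P) hmsq ha hL hk
  set μ := fluctFamily P D.msq D.a k with hμ
  set I : Set ℝ := Set.Icc (e₀ - ρ) (e₀ + ρ) with hI
  have hI_nhds : I ∈ 𝓝 e₀ := Icc_mem_nhds (by linarith) (by linarith)
  have he₀ : e₀ ∈ I := ⟨by linarith, by linarith⟩
  -- differentiability of the data and of their first derivatives, everywhere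
  have hdm2₁ : ∀ x ∈ D.Ω₁, ContDiff ℝ 1 (fun e => D.dm2 e lam' x) := fun x hx => (hdm2 x hx).of_le (by norm_num)
  have hE1₁ : ContDiff ℝ 1 (fun e => D.E1 e lam') := hE1.of_le (by norm_num)
  have hdm2d : ∀ e, ∀ x ∈ D.Ω₁, DifferentiableAt ℝ (fun u => D.dm2 u lam' x) e := fun e x hx =>
    ((hdm2₁ x hx).differentiable one_ne_zero).differentiableAt
  have hE1d : ∀ e, DifferentiableAt ℝ (fun u => D.E1 u lam') e := fun e =>
    (hE1₁.differentiable one_ne_zero).differentiableAt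
  have hd1 : ∀ x ∈ D.Ω₁, ContDiff ℝ 1 (deriv fun e => D.dm2 e lam' x) := fun x hx =>
    ((contDiff_succ_iff_deriv (n := 1)).1 (hdm2 x hx)).2.2
  have hE1d1 : ContDiff ℝ 1 (deriv fun e => D.E1 e lam') := ((contDiff_succ_iff_deriv (n := 1)).1 hE1).2.2
  have hdm2d' : ∀ e, ∀ x ∈ D.Ω₁, DifferentiableAt ℝ (deriv fun u => D.dm2 u lam' x) e := fun e x hx =>
    ((hd1 x hx).differentiable one_ne_zero).differentiableAt
  have hE1d' : ∀ e, DifferentiableAt ℝ (deriv fun u => D.E1 u lam') e := fun e =>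
    (hE1d1.differentiable one_ne_zero).differentiableAt
  set F : ℝ → ((i : Fin k) → HiggsLattice.VecField P i) × (↥D.Ω → EuclideanSpace ℝ (Fin N)) → ℝ :=
    fun e z => D.kernel14 Ak e z.1 φ z.2 * D.density14 Ak e lam' z.1 (extendZero D.Ω z.2) with hF
  set F₁ : ℝ → ((i : Fin k) → HiggsLattice.VecField P i) × (↥D.Ω → EuclideanSpace ℝ (Fin N)) → ℝ :=
    fun e z => chargeVertex D lam' Ak φ e z * F e z with hF₁
  set F₁' : ℝ → ((i : Fin k) → HiggsLattice.VecField P i) × (↥D.Ω → EuclideanSpace ℝ (Fin N)) → ℝ :=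
    fun e z => -((chargeVertex D lam' Ak φ e z ^ 2 - dChargeVertex D lam' Ak φ e z) * F e z) with hF₁'
  have hF_cont : ∀ e, Continuous (F e) := fun e =>
    continuous_fibre14₄ D e lam' continuous_const continuous_fst continuous_const continuous_snd
  have hF0 : ∀ e z, 0 ≤ F e z := fun e z =>
    mul_nonneg (D.kernel14_nonneg ha.le Ak e z.1 φ z.2) (D.density14_pos Ak e lam' z.1 (extendZero D.Ω z.2)).le
  have hF₁_meas : ∀ e, AEStronglyMeasurable (F₁ e) (μ.prod volume) := fun e =>
    (aestronglyMeasurable_chargeVertex D ha hL hk1 (hdm2d e) (hE1d e) Ak φ (μ.prod volume)).mul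
      (hF_cont e).aestronglyMeasurable
  have hderiv : ∀ z e, HasDerivAt (fun u => F₁ u z) (F₁' e z) e := by
    intro z e
    have h := (hasDerivAt_chargeDeriv_fibre14 D lam' Ak φ z (hdm2d e) (hE1d e) (hdm2d' e) (hE1d' e)).neg
    refine h.congr_of_eventuallyEq (Filter.Eventually.of_forall fun u => ?_)
    show chargeVertex D lam' Ak φ u z * F u z = -(-chargeVertex D lam' Ak φ u z * F u z)
    ring
  -- integrability of `F₁(e₀, ·)` from the first-order majorant
  obtain ⟨b₁, hb₁i, hb₁⟩ := exists_chargeDeriv_majorant D hmsq ha hL hk hℓ hq hm₀ hm₀m hmass hdm2₁ hE1₁ Ak φ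
  have hF₁_int : Integrable (F₁ e₀) (μ.prod volume) := by
    refine hb₁i.mono' (hF₁_meas e₀) (Filter.Eventually.of_forall fun z => ?_)
    rw [Real.norm_eq_abs]
    exact hb₁ e₀ he₀ z
  have hF₁'_meas : AEStronglyMeasurable (F₁' e₀) (μ.prod volume) :=
    aestronglyMeasurable_of_hasDerivAt_param hF₁_meas fun z => hderiv z e₀
  -- the second-order majorant
  obtain ⟨b₂, hb₂i, hb₂⟩ := exists_chargeDeriv2_majorant D hmsq ha hL hk hℓ hq hm₀ hm₀m hmass hdm2 hE1 Ak φ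
  have h_bound : ∀ᵐ z ∂(μ.prod volume), ∀ e ∈ I, ‖F₁' e z‖ ≤ 2 * b₂ z := by
    refine Filter.Eventually.of_forall fun z e he => ?_
    obtain ⟨h1, h2⟩ := hb₂ e he z
    rw [Real.norm_eq_abs]
    show |-((chargeVertex D lam' Ak φ e z ^ 2 - dChargeVertex D lam' Ak φ e z) * F e z)| ≤ 2 * b₂ z
    rw [abs_neg, sub_mul]
    refine (abs_sub _ _).trans ?_
    rw [abs_of_nonneg (mul_nonneg (sq_nonneg _) (hF0 e z))]
    linarith
  have hmain := (hasDerivAt_integral_of_dominated_loc_of_deriv_le hI_nhds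
    (Filter.Eventually.of_forall hF₁_meas) hF₁_int hF₁'_meas h_bound (hb₂i.const_mul 2)
    (Filter.Eventually.of_forall fun z e _ => hderiv z e)).2
  have hlim_eq : (-(∫ z, (chargeVertex D lam' Ak φ e₀ z ^ 2 - dChargeVertex D lam' Ak φ e₀ z)
        * (D.kernel14 Ak e₀ z.1 φ z.2 * D.density14 Ak e₀ lam' z.1 (extendZero D.Ω z.2)) ∂(μ.prod volume)))
      = ∫ z, F₁' e₀ z ∂(μ.prod volume) := by
    rw [← integral_neg]
  rw [hlim_eq]
  exact hmain

/-- **`∂²E_k/∂e′²` at `e′₀` equals `⟨∂_{e′}(charge vertex)⟩ − (⟨(charge vertex)²⟩ − ⟨charge vertex⟩²)`** — the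
expectation of the derived vertex minus the VARIANCE of the charge vertex in the `(e′₀, λ′)`-measure
`Z⁻¹·t·exp[…]dμ(A′)dφ′↾_Ω`; the `(α, β) = (2, 0)` content of the printed (1.5) for the typed instance (data of class
`C²` in `e′`, renormalized mass uniformly positive for `|e′ − e′₀| ≤ ρ`). (ours)
[cite: Balaban1983Higgs3, (1.4)–(1.5) p.412] -/
theorem iteratedDeriv_two_auxE_charge (hmsq : 0 < D.msq) (ha : 0 < D.a) (hL : 1 < (P.L : ℝ)) (hk1 : 1 ≤ k)
    (hk : k ≤ P.K) (hℓ : D.ell ≠ 0) {lam' : ℝ} (hq : 0 ≤ lam' * D.lamRun) {e₀ ρ m₀ : ℝ} (hρ : 0 < ρ)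
    (hm₀ : 0 < m₀) (hm₀m : m₀ ≤ D.m2)
    (hmass : ∀ e ∈ Set.Icc (e₀ - ρ) (e₀ + ρ), ∀ x ∈ D.Ω₁, m₀ ≤ D.m2 + D.dm2 e lam' x)
    (hdm2 : ∀ x ∈ D.Ω₁, ContDiff ℝ 2 (fun e => D.dm2 e lam' x)) (hE1 : ContDiff ℝ 2 (fun e => D.E1 e lam'))
    (Ak : HiggsLattice.VecField P 0) (φ : HiggsLattice.ScalarField P k N) :
    iteratedDeriv 2 (fun e => D.auxE e lam' Ak φ) e₀
      = (∫ z, dChargeVertex D lam' Ak φ e₀ z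
            * (D.kernel14 Ak e₀ z.1 φ z.2 * D.density14 Ak e₀ lam' z.1 (extendZero D.Ω z.2))
            ∂((fluctFamily P D.msq D.a k).prod volume))
          / (∫ A', D.integrand14 e₀ lam' Ak φ A' ∂(fluctFamily P D.msq D.a k))
        - ((∫ z, chargeVertex D lam' Ak φ e₀ z ^ 2
              * (D.kernel14 Ak e₀ z.1 φ z.2 * D.density14 Ak e₀ lam' z.1 (extendZero D.Ω z.2))
              ∂((fluctFamily P D.msq D.a k).prod volume))
            / (∫ A', D.integrand14 e₀ lam' Ak φ A' ∂(fluctFamily P D.msq D.a k))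
          - ((∫ z, chargeVertex D lam' Ak φ e₀ z
              * (D.kernel14 Ak e₀ z.1 φ z.2 * D.density14 Ak e₀ lam' z.1 (extendZero D.Ω z.2))
              ∂((fluctFamily P D.msq D.a k).prod volume))
            / (∫ A', D.integrand14 e₀ lam' Ak φ A' ∂(fluctFamily P D.msq D.a k))) ^ 2) := by
  haveI := HiggsFluctMeasurePos.fluctFamily_isProbability (P := P) hmsq ha hL hk
  set μ := fluctFamily P D.msq D.a k with hμ
  have hm2 : 0 < D.m2 := lt_of_lt_of_le hm₀ hm₀m
  have hdm2₁ : ∀ x ∈ D.Ω₁, ContDiff ℝ 1 (fun e => D.dm2 e lam' x) := fun x hx => (hdm2 x hx).of_le (by norm_num)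
  have hE1₁ : ContDiff ℝ 1 (fun e => D.E1 e lam') := hE1.of_le (by norm_num)
  -- abbreviations
  set F : ℝ → ((i : Fin k) → HiggsLattice.VecField P i) × (↥D.Ω → EuclideanSpace ℝ (Fin N)) → ℝ :=
    fun e z => D.kernel14 Ak e z.1 φ z.2 * D.density14 Ak e lam' z.1 (extendZero D.Ω z.2) with hF
  set Nf : ℝ → ℝ := fun e => ∫ z, chargeVertex D lam' Ak φ e z * F e z ∂(μ.prod volume) with hNf
  set Zf : ℝ → ℝ := fun e => ∫ A', D.integrand14 e lam' Ak φ A' ∂μ with hZf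
  -- (i) near `e′₀` the first derivative is `N/Z`
  have hnear : ∀ᶠ e in 𝓝 e₀, HasDerivAt (fun u => D.auxE u lam' Ak φ) (Nf e / Zf e) e := by
    have hIoo : Set.Ioo (e₀ - ρ) (e₀ + ρ) ∈ 𝓝 e₀ := Ioo_mem_nhds (by linarith) (by linarith)
    filter_upwards [hIoo] with e he
    set ρ' : ℝ := ρ - |e - e₀| with hρ'
    have habs : |e - e₀| < ρ := abs_sub_lt_iff.2 ⟨by linarith [he.2], by linarith [he.1]⟩
    have hρ'0 : 0 < ρ' := by rw [hρ']; linarith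
    have hsub : Set.Icc (e - ρ') (e + ρ') ⊆ Set.Icc (e₀ - ρ) (e₀ + ρ) := by
      intro u hu
      have h1 := hu.1
      have h2 := hu.2
      have hle := le_abs_self (e - e₀)
      have hge := neg_abs_le (e - e₀)
      exact ⟨by linarith, by linarith⟩
    exact hasDerivAt_auxE_charge D hmsq ha hL hk1 hk hℓ hq hρ'0 hm₀ hm₀m (fun u hu => hmass u (hsub hu)) hdm2₁
      hE1₁ Ak φ
  have hderiv_eq : deriv (fun u => D.auxE u lam' Ak φ) =ᶠ[𝓝 e₀] fun e => Nf e / Zf e :=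
    hnear.mono fun e h => h.deriv
  rw [iteratedDeriv_succ, iteratedDeriv_one, hderiv_eq.deriv_eq]
  -- (ii) derivatives of `N` and `Z` at `e′₀`
  have hN := hasDerivAt_integral_chargeVertex_mul D hmsq ha hL hk1 hk hℓ hq hρ hm₀ hm₀m hmass hdm2 hE1 Ak φ
  have hZ := hasDerivAt_integral_integrand14_charge D hmsq ha hL hk hℓ hq hρ hm₀ hm₀m hmass hdm2₁ hE1₁ Ak φ
  have hreg0 : 0 < lam' * D.lamRun ∨ ∀ x ∈ D.Ω₁, 0 < D.m2 + D.dm2 e₀ lam' x :=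
    Or.inr fun x hx => lt_of_lt_of_le hm₀ (hmass e₀ ⟨by linarith, by linarith⟩ x hx)
  have hZpos : 0 < Zf e₀ := integral_integrand14_pos D hmsq ha hL hk1 hk hm2 hℓ hq hreg0 Ak φ
  have hquot : HasDerivAt (fun e => Nf e / Zf e)
      ((-(∫ z, (chargeVertex D lam' Ak φ e₀ z ^ 2 - dChargeVertex D lam' Ak φ e₀ z) * F e₀ z ∂(μ.prod volume))
          * Zf e₀ - Nf e₀ * -(∫ z, chargeVertex D lam' Ak φ e₀ z * F e₀ z ∂(μ.prod volume))) / Zf e₀ ^ 2) e₀ :=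
    hN.div hZ hZpos.ne'
  rw [hquot.deriv]
  dsimp only [Nf, Zf, F]
  -- (iii) split `∫(cv² − ∂cv)·F` (both pieces integrable by the second-order majorant)
  obtain ⟨b₂, hb₂i, hb₂⟩ := exists_chargeDeriv2_majorant D hmsq ha hL hk hℓ hq hm₀ hm₀m hmass hdm2 hE1 Ak φ
  have he₀ : e₀ ∈ Set.Icc (e₀ - ρ) (e₀ + ρ) := ⟨by linarith, by linarith⟩
  have hdm2d : ∀ x ∈ D.Ω₁, DifferentiableAt ℝ (fun u => D.dm2 u lam' x) e₀ := fun x hx =>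
    ((hdm2₁ x hx).differentiable one_ne_zero).differentiableAt
  have hE1d : DifferentiableAt ℝ (fun u => D.E1 u lam') e₀ := (hE1₁.differentiable one_ne_zero).differentiableAt
  have hd1 : ∀ x ∈ D.Ω₁, ContDiff ℝ 1 (deriv fun e => D.dm2 e lam' x) := fun x hx =>
    ((contDiff_succ_iff_deriv (n := 1)).1 (hdm2 x hx)).2.2
  have hE1d1 : ContDiff ℝ 1 (deriv fun e => D.E1 e lam') := ((contDiff_succ_iff_deriv (n := 1)).1 hE1).2.2
  have hdm2d' : ∀ x ∈ D.Ω₁, DifferentiableAt ℝ (deriv fun u => D.dm2 u lam' x) e₀ := fun x hx =>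
    ((hd1 x hx).differentiable one_ne_zero).differentiableAt
  have hE1d' : DifferentiableAt ℝ (deriv fun u => D.E1 u lam') e₀ := (hE1d1.differentiable one_ne_zero).differentiableAt
  have hF_cont : Continuous (F e₀) :=
    continuous_fibre14₄ D e₀ lam' continuous_const continuous_fst continuous_const continuous_snd
  have hF0 : ∀ z, 0 ≤ F e₀ z := fun z =>
    mul_nonneg (D.kernel14_nonneg ha.le Ak e₀ z.1 φ z.2) (D.density14_pos Ak e₀ lam' z.1 (extendZero D.Ω z.2)).le
  have hcv_meas : ∀ u, (∀ x ∈ D.Ω₁, DifferentiableAt ℝ (fun u => D.dm2 u lam' x) u) →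
      DifferentiableAt ℝ (fun u => D.E1 u lam') u →
      AEStronglyMeasurable (fun z => chargeVertex D lam' Ak φ u z) (μ.prod volume) := fun u h1 h2 =>
    aestronglyMeasurable_chargeVertex D ha hL hk1 h1 h2 Ak φ (μ.prod volume)
  have hcv₀ := hcv_meas e₀ hdm2d hE1d
  -- measurability of `∂cv(e₀, ·)`: derivative-limit of the measurable `cv(u, ·)`
  have hdcv_meas : AEStronglyMeasurable (fun z => dChargeVertex D lam' Ak φ e₀ z) (μ.prod volume) := by
    have hall : ∀ u, AEStronglyMeasurable (fun z => chargeVertex D lam' Ak φ u z) (μ.prod volume) := fun u =>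
      hcv_meas u (fun x hx => ((hdm2₁ x hx).differentiable one_ne_zero).differentiableAt)
        (hE1₁.differentiable one_ne_zero).differentiableAt
    exact aestronglyMeasurable_of_hasDerivAt_param hall fun z =>
      hasDerivAt_chargeVertex D lam' Ak φ z hdm2d' hE1d'
  have hint_sq : Integrable (fun z => chargeVertex D lam' Ak φ e₀ z ^ 2 * F e₀ z) (μ.prod volume) := by
    refine hb₂i.mono' ((hcv₀.pow 2).mul hF_cont.aestronglyMeasurable) (Filter.Eventually.of_forall fun z => ?_)
    rw [Real.norm_eq_abs, abs_of_nonneg (mul_nonneg (sq_nonneg _) (hF0 z))]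
    exact (hb₂ e₀ he₀ z).1
  have hint_d : Integrable (fun z => dChargeVertex D lam' Ak φ e₀ z * F e₀ z) (μ.prod volume) := by
    refine hb₂i.mono' (hdcv_meas.mul hF_cont.aestronglyMeasurable) (Filter.Eventually.of_forall fun z => ?_)
    rw [Real.norm_eq_abs]
    exact (hb₂ e₀ he₀ z).2
  have hsplit : ∫ z, (chargeVertex D lam' Ak φ e₀ z ^ 2 - dChargeVertex D lam' Ak φ e₀ z) * F e₀ z ∂(μ.prod volume)
      = (∫ z, chargeVertex D lam' Ak φ e₀ z ^ 2 * F e₀ z ∂(μ.prod volume))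
        - ∫ z, dChargeVertex D lam' Ak φ e₀ z * F e₀ z ∂(μ.prod volume) := by
    rw [← integral_sub hint_sq hint_d]
    refine integral_congr_ae (Filter.Eventually.of_forall fun z => ?_)
    ring
  dsimp only [F] at hsplit
  rw [hsplit]
  field_simp
  ring

end SecondChargeDerivative

/-! ## 5. The mixed term: `∂_{e′}` of the one-sided `λ′`-derivative `⟨V⟩_{e′}` of `E_k` at `λ′ = λ′₀⁺`:
`∂_{e′}∂_{λ′}E_k = ⟨∂_{e′}V⟩ − Cov(V, charge vertex)` -/

section MixedDerivative

variable {k : ℕ} (D : Data14 P N k)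

/-- The `e′`-DERIVATIVE OF THE `λ′`-VERTEX `V` (`B3Eq14Finite.lamVertex`):
`½Σ_{x∈Ω₁}η^d(∂_{e′}∂_{λ′}δm²)(e′,λ′,x)(L^kε)²|φ′(x)|² + (∂_{e′}∂_{λ′}E₁)(e′,λ′)` (the `φ⁴`-vertex (1.6) carries no
charge). (ours) [cite: Balaban1983Higgs3, (1.5)–(1.7) pp.412–413] -/
noncomputable def dLamVertexCharge (e l : ℝ) (φ' : HiggsLattice.ScalarField P 0 N) : ℝ :=
  (1 / 2 : ℝ) * ∑ x ∈ D.Ω₁, P.mesh 0 ^ P.d * deriv (fun u => deriv (fun s => D.dm2 u s x) l) e * D.ell ^ 2 * ‖φ' x‖ ^ 2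
    + deriv (fun u => deriv (fun s => D.E1 u s) l) e

/-- Unfolding of `dLamVertexCharge`. [cite: Balaban1983Higgs3, (1.5)–(1.7) pp.412–413] -/
theorem dLamVertexCharge_def (e l : ℝ) (φ' : HiggsLattice.ScalarField P 0 N) :
    dLamVertexCharge D e l φ'
      = (1 / 2 : ℝ) * ∑ x ∈ D.Ω₁, P.mesh 0 ^ P.d * deriv (fun u => deriv (fun s => D.dm2 u s x) l) e
          * D.ell ^ 2 * ‖φ' x‖ ^ 2
        + deriv (fun u => deriv (fun s => D.E1 u s) l) e := rfl

/-- **The `λ′`-vertex is differentiable in the charge**, with derivative `dLamVertexCharge`, wherever the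
`λ′`-derivatives of the data at `λ′` are differentiable in `e′`. [cite: Balaban1983Higgs3, (1.5)–(1.7) pp.412–413] -/
theorem hasDerivAt_lamVertex_charge (l : ℝ) (φ' : HiggsLattice.ScalarField P 0 N) {e : ℝ}
    (hVd : ∀ x ∈ D.Ω₁, DifferentiableAt ℝ (fun u => deriv (fun s => D.dm2 u s x) l) e)
    (hVe : DifferentiableAt ℝ (fun u => deriv (fun s => D.E1 u s) l) e) :
    HasDerivAt (fun u => lamVertex D u l φ') (dLamVertexCharge D e l φ') e := by
  have h3 : HasDerivAt
      (fun u : ℝ => ∑ x ∈ D.Ω₁, P.mesh 0 ^ P.d * deriv (fun s => D.dm2 u s x) l * D.ell ^ 2 * ‖φ' x‖ ^ 2)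
      (∑ x ∈ D.Ω₁, P.mesh 0 ^ P.d * deriv (fun u => deriv (fun s => D.dm2 u s x) l) e * D.ell ^ 2 * ‖φ' x‖ ^ 2)
      e := by
    refine HasDerivAt.fun_sum (u := D.Ω₁)
      (A := fun x u => P.mesh 0 ^ P.d * deriv (fun s => D.dm2 u s x) l * D.ell ^ 2 * ‖φ' x‖ ^ 2)
      (A' := fun x => P.mesh 0 ^ P.d * deriv (fun u => deriv (fun s => D.dm2 u s x) l) e * D.ell ^ 2 * ‖φ' x‖ ^ 2)
      fun x hx => ?_
    exact (((hVd x hx).hasDerivAt.const_mul (P.mesh 0 ^ P.d)).mul_const (D.ell ^ 2)).mul_const (‖φ' x‖ ^ 2)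
  have h := ((h3.const_mul (1 / 2 : ℝ)).const_add (D.lamRun * ∑ x ∈ D.Ω₁, P.mesh 0 ^ P.d * ‖φ' x‖ ^ 4)).add
    hVe.hasDerivAt
  simp only [lamVertex_def, dLamVertexCharge_def]
  exact h

/-- `Σ_{x∈Ω₁}η^d|φ′(x)|⁴ ≤ η^d(Σ_x|φ′(x)|²)²`. [cite: Balaban1983Higgs3, (1.6) p.413] -/
theorem sum_quartic_le_sqSum_sq (φ' : HiggsLattice.ScalarField P 0 N) :
    ∑ x ∈ D.Ω₁, P.mesh 0 ^ P.d * ‖φ' x‖ ^ 4 ≤ P.mesh 0 ^ P.d * sqSum φ' ^ 2 := by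
  have hηd : 0 ≤ P.mesh 0 ^ P.d := pow_nonneg (P.mesh_pos 0).le _
  have hS0 : 0 ≤ sqSum φ' := sqSum_nonneg _
  calc ∑ x ∈ D.Ω₁, P.mesh 0 ^ P.d * ‖φ' x‖ ^ 4 ≤ ∑ x, P.mesh 0 ^ P.d * ‖φ' x‖ ^ 4 :=
        Finset.sum_le_sum_of_subset_of_nonneg (Finset.subset_univ _) fun x _ _ => by positivity
    _ ≤ ∑ x, P.mesh 0 ^ P.d * (‖φ' x‖ ^ 2 * sqSum φ') := by
        refine Finset.sum_le_sum fun x _ => mul_le_mul_of_nonneg_left ?_ hηd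
        have h := sq_le_sqSum φ' x
        calc ‖φ' x‖ ^ 4 = ‖φ' x‖ ^ 2 * ‖φ' x‖ ^ 2 := by ring
          _ ≤ ‖φ' x‖ ^ 2 * sqSum φ' := mul_le_mul_of_nonneg_left h (sq_nonneg _)
    _ = P.mesh 0 ^ P.d * sqSum φ' ^ 2 := by
        rw [← Finset.mul_sum, ← Finset.sum_mul, sqSum]; ring

/-- **The `λ′`-vertex grows at most like `|λ(L^kε)|η^d(Σ|φ′|²)² + ½η^dB_δ(L^kε)²Σ|φ′|² + B_E`** given bounds on the
`λ′`-derivatives of the data at `(e′, λ′)`. [cite: Balaban1983Higgs3, (1.5)–(1.7) pp.412–413] -/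
theorem abs_lamVertex_le {e l Bd Be : ℝ} (φ' : HiggsLattice.ScalarField P 0 N) (hBd0 : 0 ≤ Bd)
    (hBd : ∀ x ∈ D.Ω₁, |deriv (fun s => D.dm2 e s x) l| ≤ Bd) (hBe : |deriv (fun s => D.E1 e s) l| ≤ Be) :
    |lamVertex D e l φ'|
      ≤ |D.lamRun| * (P.mesh 0 ^ P.d * sqSum φ' ^ 2) + (1 / 2 : ℝ) * (P.mesh 0 ^ P.d * Bd * D.ell ^ 2 * sqSum φ')
        + Be := by
  have hηd : 0 ≤ P.mesh 0 ^ P.d := pow_nonneg (P.mesh_pos 0).le _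
  rw [lamVertex_def]
  refine (abs_add_le _ _).trans (add_le_add ((abs_add_le _ _).trans (add_le_add ?_ ?_)) hBe)
  · rw [abs_mul]
    refine mul_le_mul_of_nonneg_left ?_ (abs_nonneg _)
    rw [abs_of_nonneg (Finset.sum_nonneg fun x _ => by positivity)]
    exact sum_quartic_le_sqSum_sq D φ'
  · rw [abs_mul, abs_of_pos (by norm_num : (0 : ℝ) < 1 / 2)]
    refine mul_le_mul_of_nonneg_left ?_ (by norm_num)
    refine (Finset.abs_sum_le_sum_abs _ _).trans ?_
    have hx : ∀ x ∈ D.Ω₁, |P.mesh 0 ^ P.d * deriv (fun s => D.dm2 e s x) l * D.ell ^ 2 * ‖φ' x‖ ^ 2|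
        ≤ P.mesh 0 ^ P.d * Bd * D.ell ^ 2 * ‖φ' x‖ ^ 2 := by
      intro x hx
      rw [abs_mul, abs_mul, abs_mul, abs_of_nonneg hηd, abs_of_nonneg (sq_nonneg D.ell),
        abs_of_nonneg (sq_nonneg ‖φ' x‖)]
      have := hBd x hx
      gcongr
    refine (Finset.sum_le_sum hx).trans ?_
    rw [← Finset.mul_sum]
    refine mul_le_mul_of_nonneg_left ?_ (by positivity)
    unfold sqSum
    exact Finset.sum_le_sum_of_subset_of_nonneg (Finset.subset_univ _) fun x _ _ => sq_nonneg _

/-- **`∂_{e′}V` grows at most like `½η^dB′_δ(L^kε)²Σ|φ′|² + B′_E`** given bounds on the mixed derivatives of the data.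
[cite: Balaban1983Higgs3, (1.5)–(1.7) pp.412–413] -/
theorem abs_dLamVertexCharge_le {e l Bd Be : ℝ} (φ' : HiggsLattice.ScalarField P 0 N) (hBd0 : 0 ≤ Bd)
    (hBd : ∀ x ∈ D.Ω₁, |deriv (fun u => deriv (fun s => D.dm2 u s x) l) e| ≤ Bd)
    (hBe : |deriv (fun u => deriv (fun s => D.E1 u s) l) e| ≤ Be) :
    |dLamVertexCharge D e l φ'| ≤ (1 / 2 : ℝ) * (P.mesh 0 ^ P.d * Bd * D.ell ^ 2 * sqSum φ') + Be := by
  have hηd : 0 ≤ P.mesh 0 ^ P.d := pow_nonneg (P.mesh_pos 0).le _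
  rw [dLamVertexCharge_def]
  refine (abs_add_le _ _).trans (add_le_add ?_ hBe)
  rw [abs_mul, abs_of_pos (by norm_num : (0 : ℝ) < 1 / 2)]
  refine mul_le_mul_of_nonneg_left ?_ (by norm_num)
  refine (Finset.abs_sum_le_sum_abs _ _).trans ?_
  have hx : ∀ x ∈ D.Ω₁, |P.mesh 0 ^ P.d * deriv (fun u => deriv (fun s => D.dm2 u s x) l) e * D.ell ^ 2 * ‖φ' x‖ ^ 2|
      ≤ P.mesh 0 ^ P.d * Bd * D.ell ^ 2 * ‖φ' x‖ ^ 2 := by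
    intro x hx
    rw [abs_mul, abs_mul, abs_mul, abs_of_nonneg hηd, abs_of_nonneg (sq_nonneg D.ell),
      abs_of_nonneg (sq_nonneg ‖φ' x‖)]
    have := hBd x hx
    gcongr
  refine (Finset.sum_le_sum hx).trans ?_
  rw [← Finset.mul_sum]
  refine mul_le_mul_of_nonneg_left ?_ (by positivity)
  unfold sqSum
  exact Finset.sum_le_sum_of_subset_of_nonneg (Finset.subset_univ _) fun x _ _ => sq_nonneg _

/-- `V·t·exp[…]` is measurable on the product space (it is `−∂_{λ′}(t·exp[…])`, a limit of measurable difference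
quotients). [cite: Balaban1983Higgs3, (1.4)–(1.5) p.412] -/
theorem aestronglyMeasurable_lamVertex_mul {e l : ℝ} (hdm2 : ∀ x ∈ D.Ω₁, DifferentiableAt ℝ (fun s => D.dm2 e s x) l)
    (hE1 : DifferentiableAt ℝ (fun s => D.E1 e s) l) (Ak : HiggsLattice.VecField P 0)
    (φ : HiggsLattice.ScalarField P k N)
    (ν : Measure (((i : Fin k) → HiggsLattice.VecField P i) × (↥D.Ω → EuclideanSpace ℝ (Fin N)))) :
    AEStronglyMeasurable (fun z : ((i : Fin k) → HiggsLattice.VecField P i) × (↥D.Ω → EuclideanSpace ℝ (Fin N)) =>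
      lamVertex D e l (extendZero D.Ω z.2)
        * (D.kernel14 Ak e z.1 φ z.2 * D.density14 Ak e l z.1 (extendZero D.Ω z.2))) ν := by
  have hF_cont : ∀ s, Continuous fun z : ((i : Fin k) → HiggsLattice.VecField P i) × (↥D.Ω → EuclideanSpace ℝ (Fin N)) =>
      D.kernel14 Ak e z.1 φ z.2 * D.density14 Ak e s z.1 (extendZero D.Ω z.2) := fun s =>
    continuous_fibre14₄ D e s continuous_const continuous_fst continuous_const continuous_snd
  have hneg : ∀ s, AEStronglyMeasurable (fun z : ((i : Fin k) → HiggsLattice.VecField P i)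
      × (↥D.Ω → EuclideanSpace ℝ (Fin N)) =>
      -(D.kernel14 Ak e z.1 φ z.2 * D.density14 Ak e s z.1 (extendZero D.Ω z.2))) ν := fun s =>
    (hF_cont s).aestronglyMeasurable.neg
  refine aestronglyMeasurable_of_hasDerivAt_param (e₀ := l) hneg fun z => ?_
  have h := ((hasDerivAt_density14_lam D Ak e z.1 (extendZero D.Ω z.2) hdm2 hE1).const_mul
    (D.kernel14 Ak e z.1 φ z.2)).neg
  refine h.congr_deriv ?_
  ring

/-- The elementary estimate behind `exists_mixedDeriv_majorant`: polynomial vertex bounds times a Gaussian-dominated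
weight. [folklore] -/
private theorem mixed_pieces_le {V dV cv F S a KV KdV K₀ K₁ M c : ℝ} (hS : 0 ≤ S) (ha : 0 ≤ a) (hKV : 0 ≤ KV)
    (hKdV : 0 ≤ KdV) (hK₀ : 0 ≤ K₀) (hK₁ : 0 ≤ K₁) (hM : 0 ≤ M) (hc : 0 < c) (hV : |V| ≤ KV * (1 + S) ^ 2)
    (hdV : |dV| ≤ KdV * (1 + S) ^ 2) (hcv : |cv| ≤ (K₀ + K₁ * a) * (1 + S) ^ 2) (hF0 : 0 ≤ F)
    (hF : F ≤ M * Real.exp (-(2 * c) * S)) :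
    |V * F| ≤ (KV + KdV + KV * K₀ + KV * K₁ * a) * (M * (24 * (c⁻¹) ^ 4 * Real.exp c)) * Real.exp (-c * S) ∧
    |dV * F| ≤ (KV + KdV + KV * K₀ + KV * K₁ * a) * (M * (24 * (c⁻¹) ^ 4 * Real.exp c)) * Real.exp (-c * S) ∧
    |V * cv * F| ≤ (KV + KdV + KV * K₀ + KV * K₁ * a) * (M * (24 * (c⁻¹) ^ 4 * Real.exp c)) * Real.exp (-c * S) := by
  set J : ℝ := KV + KdV + KV * K₀ + KV * K₁ * a with hJ
  set M' : ℝ := M * (24 * (c⁻¹) ^ 4 * Real.exp c) with hM'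
  have hp1 := mul_nonneg hKV hK₀
  have hp2 := mul_nonneg (mul_nonneg hKV hK₁) ha
  have hJ0 : 0 ≤ J := by positivity
  have h1S : 1 ≤ (1 + S) ^ 2 := one_le_pow₀ (le_add_of_nonneg_right hS)
  have h24 : (1 + S) ^ 2 ≤ (1 + S) ^ 4 := by
    calc (1 + S) ^ 2 = (1 + S) ^ 2 * 1 := (mul_one _).symm
      _ ≤ (1 + S) ^ 2 * (1 + S) ^ 2 := mul_le_mul_of_nonneg_left h1S (by positivity)
      _ = (1 + S) ^ 4 := by ring
  have hexp := one_add_pow_four_mul_exp_le hc hS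
  have tail : ∀ X : ℝ, 0 ≤ X → X * (1 + S) ^ 4 * F ≤ X * M' * Real.exp (-c * S) := by
    intro X hX
    rw [hM']
    calc X * (1 + S) ^ 4 * F ≤ X * (1 + S) ^ 4 * (M * Real.exp (-(2 * c) * S)) :=
          mul_le_mul_of_nonneg_left hF (by positivity)
      _ = X * M * ((1 + S) ^ 4 * Real.exp (-(2 * c) * S)) := by ring
      _ ≤ X * M * ((24 * (c⁻¹) ^ 4 * Real.exp c) * Real.exp (-c * S)) :=
          mul_le_mul_of_nonneg_left hexp (by positivity)
      _ = X * (M * (24 * (c⁻¹) ^ 4 * Real.exp c)) * Real.exp (-c * S) := by ring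
  have hJKV : KV ≤ J := by rw [hJ]; linarith
  have hJKdV : KdV ≤ J := by rw [hJ]; linarith
  have hJprod : KV * (K₀ + K₁ * a) ≤ J := by rw [hJ]; linarith
  refine ⟨?_, ?_, ?_⟩
  · rw [abs_mul, abs_of_nonneg hF0]
    calc |V| * F ≤ KV * (1 + S) ^ 2 * F := mul_le_mul_of_nonneg_right hV hF0
      _ ≤ KV * (1 + S) ^ 4 * F := mul_le_mul_of_nonneg_right (mul_le_mul_of_nonneg_left h24 hKV) hF0
      _ ≤ J * (1 + S) ^ 4 * F := mul_le_mul_of_nonneg_right (mul_le_mul_of_nonneg_right hJKV (by positivity)) hF0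
      _ ≤ J * M' * Real.exp (-c * S) := tail _ hJ0
  · rw [abs_mul, abs_of_nonneg hF0]
    calc |dV| * F ≤ KdV * (1 + S) ^ 2 * F := mul_le_mul_of_nonneg_right hdV hF0
      _ ≤ KdV * (1 + S) ^ 4 * F := mul_le_mul_of_nonneg_right (mul_le_mul_of_nonneg_left h24 hKdV) hF0
      _ ≤ J * (1 + S) ^ 4 * F := mul_le_mul_of_nonneg_right (mul_le_mul_of_nonneg_right hJKdV (by positivity)) hF0
      _ ≤ J * M' * Real.exp (-c * S) := tail _ hJ0
  · rw [abs_mul, abs_of_nonneg hF0, abs_mul]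
    have hprod : |V| * |cv| ≤ (KV * (1 + S) ^ 2) * ((K₀ + K₁ * a) * (1 + S) ^ 2) :=
      mul_le_mul hV hcv (abs_nonneg _) (by positivity)
    calc |V| * |cv| * F ≤ (KV * (1 + S) ^ 2) * ((K₀ + K₁ * a) * (1 + S) ^ 2) * F :=
          mul_le_mul_of_nonneg_right hprod hF0
      _ = KV * (K₀ + K₁ * a) * (1 + S) ^ 4 * F := by ring
      _ ≤ J * (1 + S) ^ 4 * F := mul_le_mul_of_nonneg_right (mul_le_mul_of_nonneg_right hJprod (by positivity)) hF0
      _ ≤ J * M' * Real.exp (-c * S) := tail _ hJ0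

/-- **ONE INTEGRABLE MAJORANT of the three pieces `V·t·exp[…]`, `∂_{e′}V·t·exp[…]`, `V·(charge vertex)·t·exp[…]`**,
uniform in `e′ ∈ [e′₀−ρ, e′₀+ρ]` at fixed `λ′`: `(J₀ + J₁‖A′‖)·M·Π_{x∈Ω}e^{−c|φ′(x)|²}` (first moment of the
fluctuation family times the Gaussian fibre).  Hypotheses: those of `exists_chargeDeriv_majorant`, and the
`λ′`-derivatives of the data at `λ′`, `∂_{λ′}δm²(·,λ′,x)`, `∂_{λ′}E₁(·,λ′)`, of class `C¹` in `e′`.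
[cite: Balaban1983Higgs3, (1.4)–(1.7) pp.412–413] -/
theorem exists_mixedDeriv_majorant (hmsq : 0 < D.msq) (ha : 0 < D.a) (hL : 1 < (P.L : ℝ)) (hk : k ≤ P.K)
    (hℓ : D.ell ≠ 0) {lam' : ℝ} (hq : 0 ≤ lam' * D.lamRun) {e₀ ρ m₀ : ℝ} (hm₀ : 0 < m₀) (hm₀m : m₀ ≤ D.m2)
    (hmass : ∀ e ∈ Set.Icc (e₀ - ρ) (e₀ + ρ), ∀ x ∈ D.Ω₁, m₀ ≤ D.m2 + D.dm2 e lam' x)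
    (hdm2 : ∀ x ∈ D.Ω₁, ContDiff ℝ 1 (fun e => D.dm2 e lam' x)) (hE1 : ContDiff ℝ 1 (fun e => D.E1 e lam'))
    (hVm : ∀ x ∈ D.Ω₁, ContDiff ℝ 1 (fun u => deriv (fun s => D.dm2 u s x) lam'))
    (hVE : ContDiff ℝ 1 (fun u => deriv (fun s => D.E1 u s) lam'))
    (Ak : HiggsLattice.VecField P 0) (φ : HiggsLattice.ScalarField P k N) :
    ∃ bound : ((i : Fin k) → HiggsLattice.VecField P i) × (↥D.Ω → EuclideanSpace ℝ (Fin N)) → ℝ,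
      Integrable bound ((fluctFamily P D.msq D.a k).prod volume) ∧
      ∀ e ∈ Set.Icc (e₀ - ρ) (e₀ + ρ),
        ∀ z : ((i : Fin k) → HiggsLattice.VecField P i) × (↥D.Ω → EuclideanSpace ℝ (Fin N)),
          |lamVertex D e lam' (extendZero D.Ω z.2)
              * (D.kernel14 Ak e z.1 φ z.2 * D.density14 Ak e lam' z.1 (extendZero D.Ω z.2))| ≤ bound z ∧
          |dLamVertexCharge D e lam' (extendZero D.Ω z.2)
              * (D.kernel14 Ak e z.1 φ z.2 * D.density14 Ak e lam' z.1 (extendZero D.Ω z.2))| ≤ bound z ∧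
          |lamVertex D e lam' (extendZero D.Ω z.2) * chargeVertex D lam' Ak φ e z
              * (D.kernel14 Ak e z.1 φ z.2 * D.density14 Ak e lam' z.1 (extendZero D.Ω z.2))| ≤ bound z := by
  haveI := HiggsFluctMeasurePos.fluctFamily_isProbability (P := P) hmsq ha hL hk
  have hη1 : 0 < P.mesh 0 := P.mesh_pos 0
  have hηd : 0 ≤ P.mesh 0 ^ P.d := pow_nonneg hη1.le _
  set I : Set ℝ := Set.Icc (e₀ - ρ) (e₀ + ρ) with hI
  -- uniform bounds of the first `e′`-derivatives, of the `λ′`-derivatives and of the mixed derivatives on `I`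
  have hBdx : ∀ x : HiggsLattice.Site P 0, ∃ B : ℝ, 0 ≤ B ∧ (x ∈ D.Ω₁ → ∀ e ∈ I,
      |deriv (fun u => D.dm2 u lam' x) e| ≤ B ∧ |deriv (fun s => D.dm2 e s x) lam'| ≤ B ∧
      |deriv (fun u => deriv (fun s => D.dm2 u s x) lam') e| ≤ B) := by
    intro x
    by_cases hx : x ∈ D.Ω₁
    · obtain ⟨B₁, hB₁0, hB₁⟩ := exists_abs_le_of_continuous ((hdm2 x hx).continuous_deriv le_rfl) (e₀ - ρ) (e₀ + ρ)
      obtain ⟨B₂, hB₂0, hB₂⟩ := exists_abs_le_of_continuous (hVm x hx).continuous (e₀ - ρ) (e₀ + ρ)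
      obtain ⟨B₃, hB₃0, hB₃⟩ := exists_abs_le_of_continuous ((hVm x hx).continuous_deriv le_rfl) (e₀ - ρ) (e₀ + ρ)
      exact ⟨B₁ + B₂ + B₃, by positivity, fun _ e he =>
        ⟨(hB₁ e he).trans (by linarith), (hB₂ e he).trans (by linarith), (hB₃ e he).trans (by linarith)⟩⟩
    · exact ⟨0, le_rfl, fun h => absurd h hx⟩
  choose B hB0 hB using hBdx
  have hBd0 : 0 ≤ ∑ x, B x := Finset.sum_nonneg fun x _ => hB0 x
  have hBx : ∀ x, B x ≤ ∑ y, B y := fun x => Finset.single_le_sum (fun y _ => hB0 y) (Finset.mem_univ x)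
  have hBd1 : ∀ e ∈ I, ∀ x ∈ D.Ω₁, |deriv (fun u => D.dm2 u lam' x) e| ≤ ∑ x, B x :=
    fun e he x hx => ((hB x hx e he).1).trans (hBx x)
  have hBd2 : ∀ e ∈ I, ∀ x ∈ D.Ω₁, |deriv (fun s => D.dm2 e s x) lam'| ≤ ∑ x, B x :=
    fun e he x hx => ((hB x hx e he).2.1).trans (hBx x)
  have hBd3 : ∀ e ∈ I, ∀ x ∈ D.Ω₁, |deriv (fun u => deriv (fun s => D.dm2 u s x) lam') e| ≤ ∑ x, B x :=
    fun e he x hx => ((hB x hx e he).2.2).trans (hBx x)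
  obtain ⟨Be, hBe0, hBe⟩ := exists_abs_le_of_continuous (hE1.continuous_deriv le_rfl) (e₀ - ρ) (e₀ + ρ)
  obtain ⟨Bl, hBl0, hBl⟩ := exists_abs_le_of_continuous hVE.continuous (e₀ - ρ) (e₀ + ρ)
  obtain ⟨Bm, hBm0, hBm⟩ := exists_abs_le_of_continuous (hVE.continuous_deriv le_rfl) (e₀ - ρ) (e₀ + ρ)
  obtain ⟨KE, -, hKE⟩ := exists_abs_le_of_continuous hE1.continuous (e₀ - ρ) (e₀ + ρ)
  obtain ⟨K₀, K₁, hK₀0, hK₁0, hcv⟩ := exists_abs_chargeVertex_le D ha.le hBd0 hBe0 hBd1 hBe Ak φ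
  obtain ⟨M, hM0, hF⟩ := exists_fibre14_le_exp D ha.le hℓ hq hm₀ hm₀m hmass hKE Ak φ
  set c : ℝ := m₀ * D.ell ^ 2 * P.mesh 0 ^ P.d / 4 with hcdef
  have hℓ2 : 0 < D.ell ^ 2 := by positivity
  have hc : 0 < c := by positivity
  -- `|V| ≤ KV(1+S)²`, `|∂_{e′}V| ≤ KdV(1+S)²`
  set KV : ℝ := |D.lamRun| * P.mesh 0 ^ P.d + (1 / 2 : ℝ) * (P.mesh 0 ^ P.d * (∑ x, B x) * D.ell ^ 2) + Bl with hKV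
  set KdV : ℝ := (1 / 2 : ℝ) * (P.mesh 0 ^ P.d * (∑ x, B x) * D.ell ^ 2) + Bm with hKdV
  have hKV0 : 0 ≤ KV := by positivity
  have hKdV0 : 0 ≤ KdV := by positivity
  set J₀ : ℝ := KV + KdV + KV * K₀ with hJ₀
  set J₁ : ℝ := KV * K₁ with hJ₁
  have hJ₀0 : 0 ≤ J₀ := by positivity
  have hJ₁0 : 0 ≤ J₁ := by positivity
  set M' : ℝ := M * (24 * (c⁻¹) ^ 4 * Real.exp c) with hM'
  have hM'0 : 0 ≤ M' := by positivity
  refine ⟨fun z => (J₀ + J₁ * ‖z.1‖) * M' * ∏ x, Real.exp (-c * ‖z.2 x‖ ^ 2), ?_, fun e he z => ?_⟩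
  · exact integrable_affine_mul_gauss D hmsq ha hL hk hJ₀0 hJ₁0 hM'0 hc
  · dsimp only
    obtain ⟨hF0, hFle⟩ := hF e he z
    have hcvz := hcv e he z
    have hV := abs_lamVertex_le D (extendZero D.Ω z.2) hBd0 (hBd2 e he) (hBl e he)
    have hdV := abs_dLamVertexCharge_le D (extendZero D.Ω z.2) hBd0 (hBd3 e he) (hBm e he)
    set S : ℝ := sqSum (extendZero D.Ω z.2) with hSdef
    have hS0 : 0 ≤ S := sqSum_nonneg _
    have hS : S = ∑ x, ‖z.2 x‖ ^ 2 := sqSum_extendZero D.Ω z.2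
    have hA0 := norm_nonneg z.1
    have h1S' : 1 ≤ 1 + S := le_add_of_nonneg_right hS0
    have h1S : 1 ≤ (1 + S) ^ 2 := one_le_pow₀ h1S'
    have hSS : S ≤ (1 + S) ^ 2 :=
      (le_add_of_nonneg_left zero_le_one : S ≤ 1 + S).trans (le_self_pow₀ h1S' two_ne_zero)
    have hS2 : S ^ 2 ≤ (1 + S) ^ 2 := pow_le_pow_left₀ hS0 (le_add_of_nonneg_left zero_le_one : S ≤ 1 + S) 2
    have hW : 0 ≤ P.mesh 0 ^ P.d * (∑ x, B x) * D.ell ^ 2 := by positivity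
    have hVle : |lamVertex D e lam' (extendZero D.Ω z.2)| ≤ KV * (1 + S) ^ 2 := by
      have t1 := mul_le_mul_of_nonneg_left hS2 (mul_nonneg (abs_nonneg D.lamRun) hηd)
      have t2 := mul_le_mul_of_nonneg_left hSS hW
      have t3 := mul_le_mul_of_nonneg_left h1S hBl0
      rw [hKV]
      linarith [hV, t1, t2, t3]
    have hdVle : |dLamVertexCharge D e lam' (extendZero D.Ω z.2)| ≤ KdV * (1 + S) ^ 2 := by
      have t2 := mul_le_mul_of_nonneg_left hSS hW
      have t3 := mul_le_mul_of_nonneg_left h1S hBm0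
      rw [hKdV]
      linarith [hdV, t2, t3]
    have egauss : Real.exp (-c * S) = ∏ x, Real.exp (-c * ‖z.2 x‖ ^ 2) := by
      rw [← Real.exp_sum, hS, Finset.mul_sum]
    obtain ⟨h1, h2, h3⟩ := mixed_pieces_le hS0 hA0 hKV0 hKdV0 hK₀0 hK₁0 hM0 hc hVle hdVle hcvz hF0 hFle
    have eJ : KV + KdV + KV * K₀ + KV * K₁ * ‖z.1‖ = J₀ + J₁ * ‖z.1‖ := by rw [hJ₀, hJ₁]
    rw [eJ, ← hM', egauss] at h1 h2 h3
    exact ⟨h1, h2, by simpa only [mul_assoc] using h3⟩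

/-- **THE `e′`-DERIVATIVE OF `∫∫V·t·exp[…]` EXISTS** (two-sided, at `e′₀`, fixed `λ′`) and equals
`∫∫(∂_{e′}V − V·(charge vertex))·t·exp[…]`: dominated differentiation with the majorant `exists_mixedDeriv_majorant`.
[cite: Balaban1983Higgs3, (1.4)–(1.7) pp.412–413] -/
theorem hasDerivAt_integral_lamVertex_mul (hmsq : 0 < D.msq) (ha : 0 < D.a) (hL : 1 < (P.L : ℝ))
    (hk : k ≤ P.K) (hℓ : D.ell ≠ 0) {lam' : ℝ} (hq : 0 ≤ lam' * D.lamRun) {e₀ ρ m₀ : ℝ} (hρ : 0 < ρ)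
    (hm₀ : 0 < m₀) (hm₀m : m₀ ≤ D.m2)
    (hmass : ∀ e ∈ Set.Icc (e₀ - ρ) (e₀ + ρ), ∀ x ∈ D.Ω₁, m₀ ≤ D.m2 + D.dm2 e lam' x)
    (hdm2 : ∀ x ∈ D.Ω₁, ContDiff ℝ 1 (fun e => D.dm2 e lam' x)) (hE1 : ContDiff ℝ 1 (fun e => D.E1 e lam'))
    (hlamd : ∀ e ∈ Set.Icc (e₀ - ρ) (e₀ + ρ), ∀ x ∈ D.Ω₁, DifferentiableAt ℝ (fun s => D.dm2 e s x) lam')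
    (hlamE : ∀ e ∈ Set.Icc (e₀ - ρ) (e₀ + ρ), DifferentiableAt ℝ (fun s => D.E1 e s) lam')
    (hVm : ∀ x ∈ D.Ω₁, ContDiff ℝ 1 (fun u => deriv (fun s => D.dm2 u s x) lam'))
    (hVE : ContDiff ℝ 1 (fun u => deriv (fun s => D.E1 u s) lam'))
    (Ak : HiggsLattice.VecField P 0) (φ : HiggsLattice.ScalarField P k N) :
    HasDerivAt (fun e => ∫ z, lamVertex D e lam' (extendZero D.Ω z.2)
        * (D.kernel14 Ak e z.1 φ z.2 * D.density14 Ak e lam' z.1 (extendZero D.Ω z.2))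
        ∂((fluctFamily P D.msq D.a k).prod volume))
      (∫ z, (dLamVertexCharge D e₀ lam' (extendZero D.Ω z.2)
          - lamVertex D e₀ lam' (extendZero D.Ω z.2) * chargeVertex D lam' Ak φ e₀ z)
          * (D.kernel14 Ak e₀ z.1 φ z.2 * D.density14 Ak e₀ lam' z.1 (extendZero D.Ω z.2))
          ∂((fluctFamily P D.msq D.a k).prod volume)) e₀ := by
  haveI := HiggsFluctMeasurePos.fluctFamily_isProbability (P := P) hmsq ha hL hk
  set μ := fluctFamily P D.msq D.a k with hμ
  set I : Set ℝ := Set.Icc (e₀ - ρ) (e₀ + ρ) with hI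
  have hI_nhds : I ∈ 𝓝 e₀ := Icc_mem_nhds (by linarith) (by linarith)
  have he₀ : e₀ ∈ I := ⟨by linarith, by linarith⟩
  have hdm2d : ∀ e, ∀ x ∈ D.Ω₁, DifferentiableAt ℝ (fun u => D.dm2 u lam' x) e := fun e x hx =>
    ((hdm2 x hx).differentiable one_ne_zero).differentiableAt
  have hE1d : ∀ e, DifferentiableAt ℝ (fun u => D.E1 u lam') e := fun e =>
    (hE1.differentiable one_ne_zero).differentiableAt
  have hVmd : ∀ e, ∀ x ∈ D.Ω₁, DifferentiableAt ℝ (fun u => deriv (fun s => D.dm2 u s x) lam') e := fun e x hx =>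
    ((hVm x hx).differentiable one_ne_zero).differentiableAt
  have hVEd : ∀ e, DifferentiableAt ℝ (fun u => deriv (fun s => D.E1 u s) lam') e := fun e =>
    (hVE.differentiable one_ne_zero).differentiableAt
  set F : ℝ → ((i : Fin k) → HiggsLattice.VecField P i) × (↥D.Ω → EuclideanSpace ℝ (Fin N)) → ℝ :=
    fun e z => D.kernel14 Ak e z.1 φ z.2 * D.density14 Ak e lam' z.1 (extendZero D.Ω z.2) with hF
  set G : ℝ → ((i : Fin k) → HiggsLattice.VecField P i) × (↥D.Ω → EuclideanSpace ℝ (Fin N)) → ℝ :=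
    fun e z => lamVertex D e lam' (extendZero D.Ω z.2) * F e z with hG
  set G' : ℝ → ((i : Fin k) → HiggsLattice.VecField P i) × (↥D.Ω → EuclideanSpace ℝ (Fin N)) → ℝ :=
    fun e z => (dLamVertexCharge D e lam' (extendZero D.Ω z.2)
      - lamVertex D e lam' (extendZero D.Ω z.2) * chargeVertex D lam' Ak φ e z) * F e z with hG'
  have hF0 : ∀ e z, 0 ≤ F e z := fun e z =>
    mul_nonneg (D.kernel14_nonneg ha.le Ak e z.1 φ z.2) (D.density14_pos Ak e lam' z.1 (extendZero D.Ω z.2)).le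
  have hderiv : ∀ z, ∀ e, HasDerivAt (fun u => G u z) (G' e z) e := by
    intro z e
    have h := (hasDerivAt_lamVertex_charge D lam' (extendZero D.Ω z.2) (hVmd e) (hVEd e)).mul
      (hasDerivAt_fibre14_charge D lam' Ak φ z (hdm2d e) (hE1d e))
    refine h.congr_deriv ?_
    show dLamVertexCharge D e lam' (extendZero D.Ω z.2) * F e z
        + lamVertex D e lam' (extendZero D.Ω z.2) * (-chargeVertex D lam' Ak φ e z * F e z) = G' e z
    simp only [hG']
    ring
  -- measurability on `I` (as `−∂_{λ′}` of the fibre integrand), everywhere not needed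
  have hG_meas : ∀ᶠ e in 𝓝 e₀, AEStronglyMeasurable (G e) (μ.prod volume) := by
    filter_upwards [hI_nhds] with e he
    exact aestronglyMeasurable_lamVertex_mul D (hlamd e he) (hlamE e he) Ak φ (μ.prod volume)
  obtain ⟨b, hbi, hb⟩ := exists_mixedDeriv_majorant D hmsq ha hL hk hℓ hq hm₀ hm₀m hmass hdm2 hE1 hVm hVE Ak φ
  have hG_int : Integrable (G e₀) (μ.prod volume) := by
    refine hbi.mono' (aestronglyMeasurable_lamVertex_mul D (hlamd e₀ he₀) (hlamE e₀ he₀) Ak φ (μ.prod volume))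
      (Filter.Eventually.of_forall fun z => ?_)
    rw [Real.norm_eq_abs]
    exact (hb e₀ he₀ z).1
  -- measurability of `G′(e₀, ·)`: derivative-limit along charges inside `I`
  -- measurability of `G′(e₀, ·)`: limit of the difference quotients of `G` along `e₀ + ρ/(m+2) ∈ I`
  have hG'_meas : AEStronglyMeasurable (G' e₀) (μ.prod volume) := by
    set u : ℕ → ℝ := fun m => e₀ + ρ / ((m : ℝ) + 2) with hu
    have hu_mem : ∀ m, u m ∈ I := by
      intro m
      have hm : (2 : ℝ) ≤ (m : ℝ) + 2 := by linarith [Nat.cast_nonneg (α := ℝ) m]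
      have h1 : 0 < ρ / ((m : ℝ) + 2) := by positivity
      have h2 : ρ / ((m : ℝ) + 2) ≤ ρ := div_le_self hρ.le (by linarith)
      exact ⟨by simp only [hu]; linarith, by simp only [hu]; linarith⟩
    have hu_tend : Tendsto u atTop (𝓝[≠] e₀) := by
      refine tendsto_nhdsWithin_of_tendsto_nhds_of_eventually_within _ ?_ (Eventually.of_forall fun m => ?_)
      · have h : Tendsto (fun m : ℕ => e₀ + ρ * (1 / ((m : ℝ) + 2))) atTop (𝓝 (e₀ + ρ * 0)) := by
          refine tendsto_const_nhds.add (tendsto_const_nhds.mul ?_)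
          have h2 : Tendsto (fun m : ℕ => (m : ℝ) + 2) atTop atTop :=
            tendsto_atTop_add_const_right _ 2 tendsto_natCast_atTop_atTop
          exact tendsto_const_nhds.div_atTop h2
        rw [mul_zero, add_zero] at h
        refine h.congr fun m => ?_
        simp only [hu]; ring
      · simp only [hu, Set.mem_compl_iff, Set.mem_singleton_iff, add_eq_left, div_eq_zero_iff, not_or]
        exact ⟨hρ.ne', by linarith [Nat.cast_nonneg (α := ℝ) m]⟩
    have hlim : ∀ z, Tendsto (fun m => slope (fun e => G e z) e₀ (u m)) atTop (𝓝 (G' e₀ z)) :=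
      fun z => (hderiv z e₀).tendsto_slope.comp hu_tend
    refine aestronglyMeasurable_of_tendsto_ae atTop (fun m => ?_) (Eventually.of_forall hlim)
    have e : (fun z => slope (fun e => G e z) e₀ (u m)) = fun z => (u m - e₀)⁻¹ * (G (u m) z - G e₀ z) := by
      funext z; rw [slope_def_field, div_eq_inv_mul]
    rw [e]
    exact ((aestronglyMeasurable_lamVertex_mul D (hlamd _ (hu_mem m)) (hlamE _ (hu_mem m)) Ak φ _).sub
      (aestronglyMeasurable_lamVertex_mul D (hlamd e₀ he₀) (hlamE e₀ he₀) Ak φ _)).const_mul _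
  have h_bound : ∀ᵐ z ∂(μ.prod volume), ∀ e ∈ I, ‖G' e z‖ ≤ 2 * b z := by
    refine Filter.Eventually.of_forall fun z e he => ?_
    obtain ⟨-, h2, h3⟩ := hb e he z
    rw [Real.norm_eq_abs]
    show |(dLamVertexCharge D e lam' (extendZero D.Ω z.2)
      - lamVertex D e lam' (extendZero D.Ω z.2) * chargeVertex D lam' Ak φ e z) * F e z| ≤ 2 * b z
    rw [sub_mul]
    refine (abs_sub _ _).trans ?_
    linarith
  exact (hasDerivAt_integral_of_dominated_loc_of_deriv_le hI_nhds hG_meas hG_int hG'_meas h_bound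
    (hbi.const_mul 2) (Filter.Eventually.of_forall fun z e _ => hderiv z e)).2

/-- **THE MIXED TERM `∂_{e′}∂_{λ′}E_k` at `(e′₀, 0⁺)` equals `⟨∂_{e′}V⟩ − (⟨V·(charge vertex)⟩ − ⟨V⟩⟨charge vertex⟩)`**
— the expectation of the charge-derivative of the `λ′`-vertex minus the COVARIANCE of the `λ′`-vertex with the
charge vertex, in the `(e′₀, 0)`-measure: the `e′`-derivative at `e′₀` of the right `λ′`-derivative
`∂_{λ′}E_k(e′, 0⁺) = ⟨V⟩_{e′}` (`B3Eq14Finite.derivWithin_auxE_lam_Ici`, valid for every `e′` near `e′₀` under H7 there);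
the `(α, β) = (1, 1)` content of the printed (1.5) for the typed instance. (ours)
[cite: Balaban1983Higgs3, (1.5)–(1.7) pp.412–413] -/
theorem deriv_iteratedDerivWithin_auxE_mixed (hmsq : 0 < D.msq) (ha : 0 < D.a) (hL : 1 < (P.L : ℝ)) (hk1 : 1 ≤ k)
    (hk : k ≤ P.K) (hℓ : D.ell ≠ 0) (hrun : 0 ≤ D.lamRun) {e₀ ρ δ m₀ : ℝ} (hρ : 0 < ρ) (hδ : 0 < δ)
    (hm₀ : 0 < m₀) (hm₀m : m₀ ≤ D.m2)
    (hmass : ∀ e ∈ Set.Icc (e₀ - ρ) (e₀ + ρ), ∀ s ∈ Set.Icc (0 : ℝ) δ, ∀ x ∈ D.Ω₁, m₀ ≤ D.m2 + D.dm2 e s x)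
    (hdm2s : ∀ e ∈ Set.Icc (e₀ - ρ) (e₀ + ρ), ∀ x ∈ D.Ω₁, ContDiff ℝ 1 (fun s => D.dm2 e s x))
    (hE1s : ∀ e ∈ Set.Icc (e₀ - ρ) (e₀ + ρ), ContDiff ℝ 1 (fun s => D.E1 e s))
    (hdm2 : ∀ x ∈ D.Ω₁, ContDiff ℝ 1 (fun e => D.dm2 e 0 x)) (hE1 : ContDiff ℝ 1 (fun e => D.E1 e 0))
    (hVm : ∀ x ∈ D.Ω₁, ContDiff ℝ 1 (fun u => deriv (fun s => D.dm2 u s x) 0))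
    (hVE : ContDiff ℝ 1 (fun u => deriv (fun s => D.E1 u s) 0))
    (Ak : HiggsLattice.VecField P 0) (φ : HiggsLattice.ScalarField P k N) :
    deriv (fun e => iteratedDerivWithin 1 (fun s => D.auxE e s Ak φ) (Set.Ici 0) 0) e₀
      = (∫ z, dLamVertexCharge D e₀ 0 (extendZero D.Ω z.2)
            * (D.kernel14 Ak e₀ z.1 φ z.2 * D.density14 Ak e₀ 0 z.1 (extendZero D.Ω z.2))
            ∂((fluctFamily P D.msq D.a k).prod volume))
          / (∫ A', D.integrand14 e₀ 0 Ak φ A' ∂(fluctFamily P D.msq D.a k))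
        - ((∫ z, lamVertex D e₀ 0 (extendZero D.Ω z.2) * chargeVertex D 0 Ak φ e₀ z
              * (D.kernel14 Ak e₀ z.1 φ z.2 * D.density14 Ak e₀ 0 z.1 (extendZero D.Ω z.2))
              ∂((fluctFamily P D.msq D.a k).prod volume))
            / (∫ A', D.integrand14 e₀ 0 Ak φ A' ∂(fluctFamily P D.msq D.a k))
          - (∫ z, lamVertex D e₀ 0 (extendZero D.Ω z.2)
              * (D.kernel14 Ak e₀ z.1 φ z.2 * D.density14 Ak e₀ 0 z.1 (extendZero D.Ω z.2))
              ∂((fluctFamily P D.msq D.a k).prod volume))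
            / (∫ A', D.integrand14 e₀ 0 Ak φ A' ∂(fluctFamily P D.msq D.a k))
            * ((∫ z, chargeVertex D 0 Ak φ e₀ z
              * (D.kernel14 Ak e₀ z.1 φ z.2 * D.density14 Ak e₀ 0 z.1 (extendZero D.Ω z.2))
              ∂((fluctFamily P D.msq D.a k).prod volume))
            / (∫ A', D.integrand14 e₀ 0 Ak φ A' ∂(fluctFamily P D.msq D.a k)))) := by
  haveI := HiggsFluctMeasurePos.fluctFamily_isProbability (P := P) hmsq ha hL hk
  set μ := fluctFamily P D.msq D.a k with hμ
  have hm2 : 0 < D.m2 := lt_of_lt_of_le hm₀ hm₀m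
  have hq : 0 ≤ (0 : ℝ) * D.lamRun := le_of_eq (zero_mul _).symm
  have hI : Set.Icc (e₀ - ρ) (e₀ + ρ) ∈ 𝓝 e₀ := Icc_mem_nhds (by linarith) (by linarith)
  have he₀ : e₀ ∈ Set.Icc (e₀ - ρ) (e₀ + ρ) := ⟨by linarith, by linarith⟩
  have hmass0 : ∀ e ∈ Set.Icc (e₀ - ρ) (e₀ + ρ), ∀ x ∈ D.Ω₁, m₀ ≤ D.m2 + D.dm2 e 0 x :=
    fun e he x hx => hmass e he 0 ⟨le_rfl, hδ.le⟩ x hx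
  set F : ℝ → ((i : Fin k) → HiggsLattice.VecField P i) × (↥D.Ω → EuclideanSpace ℝ (Fin N)) → ℝ :=
    fun e z => D.kernel14 Ak e z.1 φ z.2 * D.density14 Ak e 0 z.1 (extendZero D.Ω z.2) with hF
  set NV : ℝ → ℝ := fun e => ∫ z, lamVertex D e 0 (extendZero D.Ω z.2) * F e z ∂(μ.prod volume) with hNV
  set Zf : ℝ → ℝ := fun e => ∫ A', D.integrand14 e 0 Ak φ A' ∂μ with hZf
  -- (i) near `e′₀` the one-sided `λ′`-derivative is `N_V/Z`
  have hnear : (fun e => iteratedDerivWithin 1 (fun s => D.auxE e s Ak φ) (Set.Ici 0) 0) =ᶠ[𝓝 e₀]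
      fun e => NV e / Zf e := by
    filter_upwards [hI] with e he
    exact derivWithin_auxE_lam_Ici D hmsq ha hL hk1 hk hℓ hrun hδ hm₀ hm₀m (hmass e he) (hdm2s e he) (hE1s e he) Ak φ
  rw [hnear.deriv_eq]
  -- (ii) derivatives of `N_V` and `Z` at `e′₀`
  have hlamd : ∀ e ∈ Set.Icc (e₀ - ρ) (e₀ + ρ), ∀ x ∈ D.Ω₁, DifferentiableAt ℝ (fun s => D.dm2 e s x) 0 :=
    fun e he x hx => ((hdm2s e he x hx).differentiable one_ne_zero).differentiableAt
  have hlamE : ∀ e ∈ Set.Icc (e₀ - ρ) (e₀ + ρ), DifferentiableAt ℝ (fun s => D.E1 e s) 0 :=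
    fun e he => ((hE1s e he).differentiable one_ne_zero).differentiableAt
  have hN := hasDerivAt_integral_lamVertex_mul D hmsq ha hL hk hℓ hq hρ hm₀ hm₀m hmass0 hdm2 hE1 hlamd hlamE
    hVm hVE Ak φ
  have hZ := hasDerivAt_integral_integrand14_charge D hmsq ha hL hk hℓ hq hρ hm₀ hm₀m hmass0 hdm2 hE1 Ak φ
  have hreg0 : 0 < (0 : ℝ) * D.lamRun ∨ ∀ x ∈ D.Ω₁, 0 < D.m2 + D.dm2 e₀ 0 x :=
    Or.inr fun x hx => lt_of_lt_of_le hm₀ (hmass0 e₀ he₀ x hx)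
  have hZpos : 0 < Zf e₀ := integral_integrand14_pos D hmsq ha hL hk1 hk hm2 hℓ hq hreg0 Ak φ
  have hquot : HasDerivAt (fun e => NV e / Zf e)
      (((∫ z, (dLamVertexCharge D e₀ 0 (extendZero D.Ω z.2)
          - lamVertex D e₀ 0 (extendZero D.Ω z.2) * chargeVertex D 0 Ak φ e₀ z) * F e₀ z ∂(μ.prod volume))
          * Zf e₀ - NV e₀ * -(∫ z, chargeVertex D 0 Ak φ e₀ z * F e₀ z ∂(μ.prod volume))) / Zf e₀ ^ 2) e₀ :=
    hN.div hZ hZpos.ne'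
  rw [hquot.deriv]
  -- (iii) split the integral of the difference
  obtain ⟨b, hbi, hb⟩ := exists_mixedDeriv_majorant D hmsq ha hL hk hℓ hq hm₀ hm₀m hmass0 hdm2 hE1 hVm hVE Ak φ
  have hF_cont : Continuous (F e₀) :=
    continuous_fibre14₄ D e₀ 0 continuous_const continuous_fst continuous_const continuous_snd
  have hVF_meas := aestronglyMeasurable_lamVertex_mul D (hlamd e₀ he₀) (hlamE e₀ he₀) Ak φ (μ.prod volume)
  have hdm2d : ∀ x ∈ D.Ω₁, DifferentiableAt ℝ (fun u => D.dm2 u 0 x) e₀ := fun x hx =>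
    ((hdm2 x hx).differentiable one_ne_zero).differentiableAt
  have hE1d : DifferentiableAt ℝ (fun u => D.E1 u 0) e₀ := (hE1.differentiable one_ne_zero).differentiableAt
  have hcv_meas := aestronglyMeasurable_chargeVertex D ha hL hk1 hdm2d hE1d Ak φ (μ.prod volume)
  have hFpos : ∀ z, 0 < F e₀ z := fun z =>
    mul_pos (kernel14_pos D ha hL hk1 Ak e₀ z.1 φ z.2) (D.density14_pos Ak e₀ 0 z.1 (extendZero D.Ω z.2))
  -- `V(e₀, ·)` measurable as `(V·F)/F`
  have hV_meas : AEStronglyMeasurable (fun z : ((i : Fin k) → HiggsLattice.VecField P i)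
      × (↥D.Ω → EuclideanSpace ℝ (Fin N)) => lamVertex D e₀ 0 (extendZero D.Ω z.2)) (μ.prod volume) := by
    refine (aestronglyMeasurable_iff_aemeasurable.2
      ((hVF_meas.aemeasurable.div hF_cont.aemeasurable))).congr (Filter.Eventually.of_forall fun z => ?_)
    show lamVertex D e₀ 0 (extendZero D.Ω z.2) * F e₀ z / F e₀ z = lamVertex D e₀ 0 (extendZero D.Ω z.2)
    rw [mul_div_assoc, div_self (hFpos z).ne', mul_one]
  -- `∂V(e₀, ·)` measurable: derivative-limit of `V(e, ·)`, which is continuous in `z` for each `e`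
  have hVcont : ∀ e, Continuous fun z : ((i : Fin k) → HiggsLattice.VecField P i)
      × (↥D.Ω → EuclideanSpace ℝ (Fin N)) => lamVertex D e 0 (extendZero D.Ω z.2) := by
    intro e
    simp only [lamVertex_def]
    have hx : ∀ x, Continuous fun z : ((i : Fin k) → HiggsLattice.VecField P i)
        × (↥D.Ω → EuclideanSpace ℝ (Fin N)) => ‖extendZero D.Ω z.2 x‖ := fun x =>
      ((continuous_apply x).comp ((continuous_extendZero D.Ω).comp continuous_snd)).norm
    refine ((continuous_const.mul (continuous_finsetSum _ fun x _ => continuous_const.mul ((hx x).pow 4))).add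
      (continuous_const.mul (continuous_finsetSum _ fun x _ =>
        ((continuous_const.mul ((hx x).pow 2)))))).add continuous_const
  have hdV_meas : AEStronglyMeasurable (fun z : ((i : Fin k) → HiggsLattice.VecField P i)
      × (↥D.Ω → EuclideanSpace ℝ (Fin N)) => dLamVertexCharge D e₀ 0 (extendZero D.Ω z.2)) (μ.prod volume) :=
    aestronglyMeasurable_of_hasDerivAt_param (e₀ := e₀) (fun e => (hVcont e).aestronglyMeasurable) fun z =>
      hasDerivAt_lamVertex_charge D 0 (extendZero D.Ω z.2)
        (fun x hx => ((hVm x hx).differentiable one_ne_zero).differentiableAt)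
        (hVE.differentiable one_ne_zero).differentiableAt
  have hint1 : Integrable (fun z => dLamVertexCharge D e₀ 0 (extendZero D.Ω z.2) * F e₀ z) (μ.prod volume) := by
    refine hbi.mono' (hdV_meas.mul hF_cont.aestronglyMeasurable) (Filter.Eventually.of_forall fun z => ?_)
    rw [Real.norm_eq_abs]
    exact (hb e₀ he₀ z).2.1
  have hint2 : Integrable (fun z => lamVertex D e₀ 0 (extendZero D.Ω z.2) * chargeVertex D 0 Ak φ e₀ z * F e₀ z)
      (μ.prod volume) := by
    refine hbi.mono' ((hV_meas.mul hcv_meas).mul hF_cont.aestronglyMeasurable)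
      (Filter.Eventually.of_forall fun z => ?_)
    rw [Real.norm_eq_abs]
    exact (hb e₀ he₀ z).2.2
  have hsplit : ∫ z, (dLamVertexCharge D e₀ 0 (extendZero D.Ω z.2)
        - lamVertex D e₀ 0 (extendZero D.Ω z.2) * chargeVertex D 0 Ak φ e₀ z) * F e₀ z ∂(μ.prod volume)
      = (∫ z, dLamVertexCharge D e₀ 0 (extendZero D.Ω z.2) * F e₀ z ∂(μ.prod volume))
        - ∫ z, lamVertex D e₀ 0 (extendZero D.Ω z.2) * chargeVertex D 0 Ak φ e₀ z * F e₀ z ∂(μ.prod volume) := by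
    rw [← integral_sub hint1 hint2]
    refine integral_congr_ae (Filter.Eventually.of_forall fun z => ?_)
    ring
  dsimp only [NV, Zf, F]
  dsimp only [F] at hsplit
  rw [hsplit]
  field_simp
  ring

end MixedDerivative

/-! ## 6. The repaired interaction (1.5) TO SECOND ORDER: all five terms genuine derivatives -/

section SecondOrderInteraction

variable {k : ℕ} (D : Data14 P N k)

/-- `{(α,β) : 1 ≤ α+β ≤ 2} = {(1,0),(0,1),(2,0),(1,1),(0,2)}`. [cite: Balaban1983Higgs3, (1.5) p.412] -/
theorem idx15_two : B3Sect1Counterterms.idx15 2 = {(1, 0), (0, 1), (2, 0), (1, 1), (0, 2)} := by decide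

/-- **(1.5) for `n̄ = 2`, term by term**: `𝒫^{(k)}_{n̄=2} = ∂_{e′}E_k|₀ + ∂⁺_{λ′}E_k|₀ + ½∂²_{e′}E_k|₀ +
∂_{e′}∂⁺_{λ′}E_k|₀ + ½(∂⁺_{λ′})²E_k|₀` for the one-sided reading `B3Eq15OneSidedInteraction.interaction15R` (pure
bookkeeping of the `(α!β!)⁻¹`-weighted sum over `idx15 2`; the five derivative symbols are identified by
`B3Eq15ChargeDerivative.hasDerivAt_auxE_charge`, `B3Eq14Finite.derivWithin_auxE_lam_Ici`,
`iteratedDeriv_two_auxE_charge`, `deriv_iteratedDerivWithin_auxE_mixed`, `B3Eq14Finite.iteratedDerivWithin_two_auxE_lam_Ici`).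
[cite: Balaban1983Higgs3, (1.5) p.412] -/
theorem interaction15R_two_eq_derivs (Ak : HiggsLattice.VecField P 0) (φ : HiggsLattice.ScalarField P k N) :
    B3Eq15OneSidedInteraction.interaction15R D 2 Ak φ
      = deriv (fun e' => D.auxE e' 0 Ak φ) 0
        + iteratedDerivWithin 1 (fun l' => D.auxE 0 l' Ak φ) (Set.Ici 0) 0
        + (1 / 2 : ℝ) * iteratedDeriv 2 (fun e' => D.auxE e' 0 Ak φ) 0
        + deriv (fun e' => iteratedDerivWithin 1 (fun l' => D.auxE e' l' Ak φ) (Set.Ici 0) 0) 0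
        + (1 / 2 : ℝ) * iteratedDerivWithin 2 (fun l' => D.auxE 0 l' Ak φ) (Set.Ici 0) 0 := by
  rw [B3Eq15OneSidedInteraction.interaction15R, idx15_two, Finset.sum_insert (by decide),
    Finset.sum_insert (by decide), Finset.sum_insert (by decide), Finset.sum_pair (by decide)]
  have h0 : ∀ e' : ℝ, iteratedDerivWithin 0 (fun l' => D.auxE e' l' Ak φ) (Set.Ici 0) 0 = D.auxE e' 0 Ak φ :=
    fun e' => by rw [iteratedDerivWithin_zero]
  simp only [Nat.factorial_zero, Nat.factorial_one, Nat.factorial_two, Nat.cast_one, Nat.cast_ofNat, mul_one,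
    one_mul, div_one, iteratedDeriv_zero, iteratedDeriv_one, h0]
  ring

/-- **THE REPAIRED INTERACTION (1.5) TO SECOND ORDER — ALL FIVE TERMS GENUINE DERIVATIVES, EXPLICITLY**:
`𝒫^{(k)}_{n̄=2}(Ω₁, A^{(k)}, φ) = ⟨cv⟩₀ + ⟨V⟩₀ + ½(⟨∂_{e′}cv⟩₀ − Var₀ cv) + (⟨∂_{e′}V⟩₀ − Cov₀(V, cv)) +
½(⟨∂_{λ′}V⟩₀ − Var₀ V)` in the base-point measure `Z₀⁻¹·t·exp[…]|_{e′=λ′=0}dμ(A′)dφ′↾_Ω`, `cv` the charge vertex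
(`B3Eq15ChargeDerivative.chargeVertex`), `V` the `λ′`-vertex (`B3Eq14Finite.lamVertex`), `∂_{λ′}V = lamVertex2`.
Hypotheses (H2): `μ₀² > 0`, `a > 0`, `L > 1`, `1 ≤ k ≤ K`, `L^kε ≠ 0`, `λ(L^kε) ≥ 0`, `0 < m₀ ≤ m²`, a renormalized
mass `≥ m₀` on `Ω₁` for `(e′, λ′) ∈ [−ρ, ρ] × [0, δ]`, and counterterm data with `δm²(0,·,x)`, `E₁(0,·)` of class
`C²`, `δm²(e′,·,x)`, `E₁(e′,·)` of class `C¹` for `|e′| ≤ ρ`, `δm²(·,0,x)`, `E₁(·,0)` of class `C²`, and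
`∂_{λ′}δm²(·,0,x)`, `∂_{λ′}E₁(·,0)` of class `C¹`. (ours) [cite: Balaban1983Higgs3, (1.5)–(1.7) pp.412–413] -/
theorem interaction15R_two_eq_expectations (hmsq : 0 < D.msq) (ha : 0 < D.a) (hL : 1 < (P.L : ℝ))
    (hk1 : 1 ≤ k) (hk : k ≤ P.K) (hℓ : D.ell ≠ 0) (hrun : 0 ≤ D.lamRun) {δ ρ m₀ : ℝ} (hδ : 0 < δ) (hρ : 0 < ρ)
    (hm₀ : 0 < m₀) (hm₀m : m₀ ≤ D.m2)
    (hmass : ∀ e ∈ Set.Icc (-ρ) ρ, ∀ s ∈ Set.Icc (0 : ℝ) δ, ∀ x ∈ D.Ω₁, m₀ ≤ D.m2 + D.dm2 e s x)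
    (hdm2s0 : ∀ x ∈ D.Ω₁, ContDiff ℝ 2 (fun s => D.dm2 0 s x)) (hE1s0 : ContDiff ℝ 2 (fun s => D.E1 0 s))
    (hdm2s : ∀ e ∈ Set.Icc (-ρ) ρ, ∀ x ∈ D.Ω₁, ContDiff ℝ 1 (fun s => D.dm2 e s x))
    (hE1s : ∀ e ∈ Set.Icc (-ρ) ρ, ContDiff ℝ 1 (fun s => D.E1 e s))
    (hdm2e : ∀ x ∈ D.Ω₁, ContDiff ℝ 2 (fun e => D.dm2 e 0 x)) (hE1e : ContDiff ℝ 2 (fun e => D.E1 e 0))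
    (hVm : ∀ x ∈ D.Ω₁, ContDiff ℝ 1 (fun u => deriv (fun s => D.dm2 u s x) 0))
    (hVE : ContDiff ℝ 1 (fun u => deriv (fun s => D.E1 u s) 0))
    (Ak : HiggsLattice.VecField P 0) (φ : HiggsLattice.ScalarField P k N) :
    B3Eq15OneSidedInteraction.interaction15R D 2 Ak φ
      = (∫ z, chargeVertex D 0 Ak φ 0 z
            * (D.kernel14 Ak 0 z.1 φ z.2 * D.density14 Ak 0 0 z.1 (extendZero D.Ω z.2))
            ∂((fluctFamily P D.msq D.a k).prod volume))
          / (∫ A', D.integrand14 0 0 Ak φ A' ∂(fluctFamily P D.msq D.a k))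
        + (∫ z, lamVertex D 0 0 (extendZero D.Ω z.2)
            * (D.kernel14 Ak 0 z.1 φ z.2 * D.density14 Ak 0 0 z.1 (extendZero D.Ω z.2))
            ∂((fluctFamily P D.msq D.a k).prod volume))
          / (∫ A', D.integrand14 0 0 Ak φ A' ∂(fluctFamily P D.msq D.a k))
        + (1 / 2 : ℝ) * ((∫ z, dChargeVertex D 0 Ak φ 0 z
            * (D.kernel14 Ak 0 z.1 φ z.2 * D.density14 Ak 0 0 z.1 (extendZero D.Ω z.2))
            ∂((fluctFamily P D.msq D.a k).prod volume))
          / (∫ A', D.integrand14 0 0 Ak φ A' ∂(fluctFamily P D.msq D.a k))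
          - ((∫ z, chargeVertex D 0 Ak φ 0 z ^ 2
            * (D.kernel14 Ak 0 z.1 φ z.2 * D.density14 Ak 0 0 z.1 (extendZero D.Ω z.2))
            ∂((fluctFamily P D.msq D.a k).prod volume))
          / (∫ A', D.integrand14 0 0 Ak φ A' ∂(fluctFamily P D.msq D.a k))
            - ((∫ z, chargeVertex D 0 Ak φ 0 z
            * (D.kernel14 Ak 0 z.1 φ z.2 * D.density14 Ak 0 0 z.1 (extendZero D.Ω z.2))
            ∂((fluctFamily P D.msq D.a k).prod volume))
          / (∫ A', D.integrand14 0 0 Ak φ A' ∂(fluctFamily P D.msq D.a k))) ^ 2))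
        + ((∫ z, dLamVertexCharge D 0 0 (extendZero D.Ω z.2)
            * (D.kernel14 Ak 0 z.1 φ z.2 * D.density14 Ak 0 0 z.1 (extendZero D.Ω z.2))
            ∂((fluctFamily P D.msq D.a k).prod volume))
          / (∫ A', D.integrand14 0 0 Ak φ A' ∂(fluctFamily P D.msq D.a k))
          - ((∫ z, lamVertex D 0 0 (extendZero D.Ω z.2) * chargeVertex D 0 Ak φ 0 z
            * (D.kernel14 Ak 0 z.1 φ z.2 * D.density14 Ak 0 0 z.1 (extendZero D.Ω z.2))
            ∂((fluctFamily P D.msq D.a k).prod volume))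
          / (∫ A', D.integrand14 0 0 Ak φ A' ∂(fluctFamily P D.msq D.a k))
            - (∫ z, lamVertex D 0 0 (extendZero D.Ω z.2)
            * (D.kernel14 Ak 0 z.1 φ z.2 * D.density14 Ak 0 0 z.1 (extendZero D.Ω z.2))
            ∂((fluctFamily P D.msq D.a k).prod volume))
          / (∫ A', D.integrand14 0 0 Ak φ A' ∂(fluctFamily P D.msq D.a k))
              * ((∫ z, chargeVertex D 0 Ak φ 0 z
            * (D.kernel14 Ak 0 z.1 φ z.2 * D.density14 Ak 0 0 z.1 (extendZero D.Ω z.2))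
            ∂((fluctFamily P D.msq D.a k).prod volume))
          / (∫ A', D.integrand14 0 0 Ak φ A' ∂(fluctFamily P D.msq D.a k)))))
        + (1 / 2 : ℝ) * ((∫ z, lamVertex2 D 0 0 (extendZero D.Ω z.2)
            * (D.kernel14 Ak 0 z.1 φ z.2 * D.density14 Ak 0 0 z.1 (extendZero D.Ω z.2))
            ∂((fluctFamily P D.msq D.a k).prod volume))
          / (∫ A', D.integrand14 0 0 Ak φ A' ∂(fluctFamily P D.msq D.a k))
          - ((∫ z, lamVertex D 0 0 (extendZero D.Ω z.2) ^ 2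
            * (D.kernel14 Ak 0 z.1 φ z.2 * D.density14 Ak 0 0 z.1 (extendZero D.Ω z.2))
            ∂((fluctFamily P D.msq D.a k).prod volume))
          / (∫ A', D.integrand14 0 0 Ak φ A' ∂(fluctFamily P D.msq D.a k))
            - ((∫ z, lamVertex D 0 0 (extendZero D.Ω z.2)
            * (D.kernel14 Ak 0 z.1 φ z.2 * D.density14 Ak 0 0 z.1 (extendZero D.Ω z.2))
            ∂((fluctFamily P D.msq D.a k).prod volume))
          / (∫ A', D.integrand14 0 0 Ak φ A' ∂(fluctFamily P D.msq D.a k))) ^ 2)) := by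
  have hI : ∀ e ∈ Set.Icc (0 - ρ) (0 + ρ), e ∈ Set.Icc (-ρ) ρ := fun e he =>
    ⟨by linarith [he.1], by linarith [he.2]⟩
  have hq : 0 ≤ (0 : ℝ) * D.lamRun := le_of_eq (zero_mul _).symm
  have hmass0 : ∀ e ∈ Set.Icc (0 - ρ) (0 + ρ), ∀ x ∈ D.Ω₁, m₀ ≤ D.m2 + D.dm2 e 0 x :=
    fun e he x hx => hmass e (hI e he) 0 ⟨le_rfl, hδ.le⟩ x hx
  have hmass2 : ∀ e ∈ Set.Icc (0 - ρ) (0 + ρ), ∀ s ∈ Set.Icc (0 : ℝ) δ, ∀ x ∈ D.Ω₁, m₀ ≤ D.m2 + D.dm2 e s x :=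
    fun e he => hmass e (hI e he)
  have hmassl : ∀ s ∈ Set.Icc (0 : ℝ) δ, ∀ x ∈ D.Ω₁, m₀ ≤ D.m2 + D.dm2 0 s x :=
    hmass 0 ⟨by linarith, hρ.le⟩
  have hdm2e₁ : ∀ x ∈ D.Ω₁, ContDiff ℝ 1 (fun e => D.dm2 e 0 x) := fun x hx => (hdm2e x hx).of_le (by norm_num)
  have hE1e₁ : ContDiff ℝ 1 (fun e => D.E1 e 0) := hE1e.of_le (by norm_num)
  have hdm2s0₁ : ∀ x ∈ D.Ω₁, ContDiff ℝ 1 (fun s => D.dm2 0 s x) := fun x hx => (hdm2s0 x hx).of_le (by norm_num)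
  have hE1s0₁ : ContDiff ℝ 1 (fun s => D.E1 0 s) := hE1s0.of_le (by norm_num)
  have h10 := (hasDerivAt_auxE_charge D hmsq ha hL hk1 hk hℓ hq hρ hm₀ hm₀m hmass0 hdm2e₁ hE1e₁ Ak φ).deriv
  have h01 := derivWithin_auxE_lam_Ici D hmsq ha hL hk1 hk hℓ hrun hδ hm₀ hm₀m hmassl hdm2s0₁ hE1s0₁ Ak φ
  have h20 := iteratedDeriv_two_auxE_charge D hmsq ha hL hk1 hk hℓ hq hρ hm₀ hm₀m hmass0 hdm2e hE1e Ak φ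
  have h11 := deriv_iteratedDerivWithin_auxE_mixed D hmsq ha hL hk1 hk hℓ hrun hρ hδ hm₀ hm₀m hmass2
    (fun e he => hdm2s e (hI e he)) (fun e he => hE1s e (hI e he)) hdm2e₁ hE1e₁ hVm hVE Ak φ
  have h02 := iteratedDerivWithin_two_auxE_lam_Ici D hmsq ha hL hk1 hk hℓ hrun hδ hm₀ hm₀m hmassl hdm2s0 hE1s0 Ak φ
  rw [interaction15R_two_eq_derivs, h11, h10, h01, h20, h02]

end SecondOrderInteraction

end

end Literature.MathematicalPhysics.QuantumFieldTheory.Balaban1983to89.B3Eq15ChargeSecondOrder
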